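import Summits.QuantumFields.YangMills.Theses.UnitScaleTilt
import Summits.QuantumFields.YangMills.Theorems.AlphaInputsT3ACv2RecHistories
import Summits.QuantumFields.YangMills.Theorems.UnitScaleTiltHistoryTailChessboardT3
import Summits.QuantumFields.YangMills.Theorems.UnitScaleTiltHistoryTailAlphaConsumer
import Summits.QuantumFields.YangMills.Theorems.UnitScaleTiltHistoryTailStubBudget
import Summits.QuantumFields.YangMills.Theorems.UnitScaleTiltHistoryTailPerPlaquetteV3b
import Summits.QuantumFields.YangMills.Theorems.UnitScaleTiltHistoryTailBoundedHeight
import Summits.QuantumFields.YangMills.Theorems.UnitScaleTiltHistoryTailDiluteExponentOneLt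
import Summits.QuantumFields.YangMills.Theorems.UnitScaleTiltHistoryTailLowMass
import Summits.QuantumFields.YangMills.Theorems.UnitScaleTiltHistoryTailHistoryMassWOneLt
import HarnessLib

/-!
# BC3 birth skeleton v5p6-pre = v5p5 (b9c0b7e63efc4b91, owner ym3-torus-plan g18) WITH THE BLOCK-SIZE FLOOR REMOVED: binders `Odd L → 1 < L` on 2″/2‴/4a/4b/4c, the «1 < L» editions of 4a/4b/4c BY NAME, STUB 5′ `stub_perPlaquetteSmallBlocks` DELETED — crux `HistoryTailL` (route `UnitScaleTilt`, item stmt-QuantumFields-19936); fleet lead ★ym-ust-18916-p1 g4, 2026-08-27 (RULING g18-№3 §3(v)/§4, REBASE-CHECKLIST-v5p6-v5i items 4–5); ns `…Cruxes.HistoryTailL.BirthV5p6pre`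

v5p6-pre (this file; the TEMPLATE of the v3 re-base v5p6, checkable TODAY on the v2 package): THREE stubs {2′ `stub_laneRecords`, 2″ `stub_alphaOfLaneFull`, 2‴
`stub_windowedWeights`}, all lane rows.  DELTA to v5p5: (1) binder `7 ≤ L` ↦ `1 < L` in 2″, 2‴, 4c, 4b; (2) 4c := `HistoryTailDiluteExponent.diluteExponent_of_one_lt` (★19201-p1 g5),
4b := `HistoryTailLowMass.stub_lowMass_of_one_lt` (p498596), 4a := `HistoryTailHistoryMassW.historyMassBound_of_weights_of_one_lt` (p505794) BY NAME; (3) `perPlaquetteHigh_lane`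
takes `1 < L` (it used `7 ≤ L` only to feed the stubs); (4) `perPlaquetteHighL` has no `by_cases 7 ≤ L` and STUB 5′ is gone (every by-name input is «1 < L»: chessboard
`chessboardRP_T3`, `stub_budget`, `perPlaquette_of_split`, `stub_tailOfPerPlaquette` are L-free).  Farm: rc 0, sorries 3 = stubs, `HistoryTailL_of` BY NAME; probes 9/9 FAIL.
v5p6 PROPER = this file ∘ the rename `OfV2At ↦ OfV3At`, `dataT3c ↦ (v3 datum)`, `lfDataT3c ↦ (v3 LF data)`, `dataT3c_* ↦ v3 twins` (ineq47AE, integrable_low,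
integral_low_pos, chiRange, rmSize — used in §2) ∘ (2‴ := THE BUNDLE `OfV3At.windowedWeights` by name, deleted as a stub; 2″(d) by name) ∘ (2′ := `stub_laneRecordsV3`),
once ★alpha-1's v3 socket and the 4a/4b/4c v3 twins have p-ids.  CAVEAT P-g18-1 (RULING g18-№3 §0.3) stands for every line typed through the v2 socket, this one included.

REPAIR (v5p5, F-α1-9, lit-balaban typer g42 05:55:08Z — located, kernel-mechanism quoted): at level `j = 0` the history type is ONE POINT (`Carriers.Hist.instUnique`),
`resDensity … 0 = boltzmann > 0` everywhere, so (iv) forces `wt′ K 0 triv W > 0` a.e. and v5p4's (w2) then forced the level-0 (40)-window a.e. — false for small `γ`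
(the window's complement is open of positive Haar measure); print has NO characteristic function at level 0 ((40) p.266 «χ_j, j = 1, …, k»; (41)₀ is (1), `m₀ = 1`).
v5p5 = v5p4 with (w2) asked for levels `1 ≤ j` ONLY (guard `1 ≤ j →`); the composition needs (w2) only at tail levels `j > j₀ ≥ 0` (`perPlaquetteHigh_lane`, `hj1`)
and feeds 4a-generic's (w2) (stated for `r ≠ trivReg` at every `j ≤ K`) by the vacuous level-0 case (`Hist.eq_triv_zero`).  Everything else byte-identical with v5p4.

= v5p (064c15926725cd98) RE-CUT for the v3′ crux `HistoryTailL` («∀ L b₁ p₁, ∃ (b₀,p₀) ⪰ (b₁,p₁), …, ∀ m > 0, ∃ γ₁, …») with F-g3-1's repair: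

* STUB 2′ `stub_laneRecords` — BYTE-IDENTICAL with 19935's v5h rev 2: ★alpha-1's record-parametric v2 socket `Theorems.AlphaInputsT3ACv2Rec L` BY NAME
  (for every profile beyond thresholds a record `𝔠` with `(𝔠.b₀, 𝔠.p₀)` = that profile and family-uniform [7]-constants `a₀ a₁`, `OfV2At F 𝔠 a₀ a₁`).
* STUB 2″ `stub_alphaOfLaneFull` — THE LANE'S FLOOR-INDEPENDENT DELIVERABLES AT ITS OWN CONCRETE DATUM `OfV2At.dataT3c` / `lfDataT3c` (p481907 / p482937), at the
  record's OWN p-function: (a) `LargePSpec` ((67) p.273), (b) `SmallFactor71` ((70)–(71) p.273), (c) `PintSize` at `CP` ((46) p.267), (d) the size of `Zterm`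
  ((41) p.266) at `κZ` — none reads the history weights.
* STUB 2‴ `stub_windowedWeights` (lead findings F-g3-2 / F-g3-3; replaces v5p3's `stub_windowedTrivialWeight` AND absorbs the weight clauses 4a needs):
  the CURRENT datum's trivial weight is FLOORED `≥ 1` at every `W` (`lfDataT3c_one_le_wt_trivReg`) and the non-trivial masses inherit the floored prefix (their
  integrals grow with the level), so no K-uniform numerator bound on `up_{dataT3c}` is dischargeable.  This stub asks the lane for print's windowed weights
  ((40)–(41) p.266, `χ_j`) of ALL region histories in a form typeable TODAY: `∃ wt′` with (w0) `≥ 0`, (w1) `= 0` on inadmissible histories, (w2) a.e. support on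
  `Adm` at levels `1 ≤ j` (the trivial history included = the window; level 0 carries no window — F-α1-9, print (40) p.266 `j = 1,…,k`), (e′) `Integrable ∧ ∫ wt′ ≤ Bm` with `Bm` fixed with the record (K-uniform), (e″) `Pint_j(r, ·)` measurable for
  every `j ≤ K` (today the package delivers it at `j = K` only, `terminal_measurable_Pint`), and (iv) (41′) a.e. + integrability for the majorant assembled from `wt′`
  (the datum `dataT3c` with `LF` replaced, inline) — = RULING g17-№1 §D(1) task #1 with the (55)/(57) step re-run; the ∃-witness feeds only pinned consumers (no dial).
* the chessboard (v5p STUB 3) is the LANDED theorem `HistoryTailChessboardT3.chessboardRP_T3` (ym-infvol-p3 g4, p481363) — inlined, not a stub.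
* 4c `stub_diluteExponent` — LANDED BY NAME (p497276 `HistoryTailDiluteExponent.diluteExponent`; kept under its v5p3 name with a by-name body, NOT a stub of v5p4) — DETERMINISTIC (no measure, no weights: dials E1/E4/D5 cannot touch it; constants after `𝔠`: D1 closed): for the concrete datum,
  an admissible pair `(h, W)` with `W ∈ E_S`, `S` `ccol·x_j^{r₀}`-separated:
  `|S|·¼p_j² + Σ_{i<j} #P_i(h)·σ(i,j) ≤ mainT_j(h,W) − Zterm_j(h)`, `σ(i,j) = (b₀²/200)·x_i^{2p₀−1}·(x_i − x_j)`, `x_i = 1 + log g_{K−i}⁻¹` — deep members by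
  `HistoryTailAlphaTopFamily.card_mul_quarter_le_mainT_of_separated` (p477621), the others by the history's own large-plaquette clusters (SmallFactor71 + LargePSpec
  + the collar towers, reach `HistoryTailTowerReach.exists_source_within_reach`, p484215), towers paying `Zterm`; closes because `2𝔠.p₀ − 2 − 3𝔠.r₀ = 𝔠.r₀ > 0`.
* 4a — LANDED BY NAME in weight-generic form (p500278 `HistoryTailHistoryMassW.historyMassBound_of_weights`, applied in §2 to 2‴'s `wt′`; NOT a stub of v5p4) —
  THE RESUMMATION over the NON-TRIVIAL region histories ([Balaban1985UV3] Thm 1 (5) p.256 «ρ_k ≤ exp O(1)|T₁^{(k)}|», [9] §3.C): for any weight family with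
  (w0)(w1)(w2)(e′)(e″) and `PintSize CP`, `∫ Σ_{r ≠ triv} wt′(r,W)·e^{Pint(r,W) − Σ_i #P_i(r)σ(i,j)} dW ≤ e^{(CP+3+Bm)·x_j·N_j³}` (+ integrability) for `γ ≤ γa`.
* 4b `stub_lowMass` — LANDED BY NAME (p497206 `HistoryTailLowMass.stub_lowMass`, ym3-torus-p2 g11; kept under its v5p3 name with a by-name body, NOT a stub of v5p4) — the Gaussian window mass of the (47)-minorant of the concrete datum: `e^{−CL·x_j·N_j³} ≤ ∫ low_D` (χ = window indicator
  `dataT3c_chi_eq`, a competitor bound for `mainT(triv, ·)` on the `g_j`-window, SU(2) Haar ball volume; print: the lower half of (5) integrated).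
* (v5p5's STUB 5′ `stub_perPlaquetteSmallBlocks`, odd `L < 7`, is DELETED in v5p6-pre: the «1 < L» editions make the large-`L` chain run for every odd `L ≥ 3`.)
* §2 (NO sorry): Mechanism A on `⋂_S E′` from the DELIVERED a.e. envelopes of the concrete datum (`dataT3c_ineq41AE/47AE/envelopeRegular/chiRange`,
  `dataT3c_rmSize`), the numerator bound from 4c+4a+4b+2‴ (`setIntegral_up_le`, weight family as a parameter), the |S|-th root and the exponent algebra of v5p, the per-plaquette
  tail in threshold form (`perPlaquetteHighL`), then v4's tail chain (`stub_budget` p442213, `perPlaquette_of_split` p438760, `stub_tailOfPerPlaquette` p432346,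
  `historyTailAt_of_averagedTailAt`) ⇒ **`HistoryTailL_of : …Theses.UnitScaleTilt.HistoryTailL` BY NAME**, the profile `(𝔠.b₀, 𝔠.p₀)` fixed BEFORE `m`.
DIAL AUDIT (owner №2 (4)/(5)): the only stub quantified over histories/data in the abstract is 4c, which is weight-free and measure-free; 2″(c)–(f), 4a, 4b name the
concrete datum `OfV2At.dataT3c h hc γ hγ hγ1 π` / `lfDataT3c`, with every constant existential AFTER `(𝔠, a₀, a₁)`; `Cχ` is the literal 1 of `dataT3c_chi_eq_zero_of_le`.
v5p6-pre: THREE stubs {2′, 2″, 2‴} — all LANE rows; the history side (4a/4b/4c) is landed in «1 < L» form.  v5p5: header + the (w2) guard + two call sites by the route owner (ym3-torus-plan g18) over the lead's bytes bd6b13bc65aaba65; everything else byte-identical.  [cite: Balaban1985UV3, (5) p.256, (38)–(47) pp.266–267, (67)–(71) pp.273–274, Thm 2 p.272; King1986, (3.12) p.657]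
-/

set_option autoImplicit false

noncomputable section

open MeasureTheory
open Literature.MathematicalPhysics.QuantumFieldTheory.Balaban1983to89
open Literature.MathematicalPhysics.QuantumFieldTheory.Balaban1983to89.T3ContinuumYM3Torus
open Literature.MathematicalPhysics.QuantumFieldTheory.Balaban1983to89.T3UnitScaleTilt
open Literature.MathematicalPhysics.QuantumFieldTheory.Balaban1983to89.T3UnitLawDensityEML
open Literature.MathematicalPhysics.QuantumFieldTheory.Balaban1983to89.T3BareTailProfile
open Literature.MathematicalPhysics.QuantumFieldTheory.Balaban1983to89.T3ThresholdSmallness (sqrt_coupling_pos_le)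
open Literature.MathematicalPhysics.QuantumFieldTheory.Balaban1983to89.T3Thresholds (coupling_le_one)
open Literature.MathematicalPhysics.QuantumFieldTheory.Balaban1983to89.T3AlphaInputsAC
open Literature.MathematicalPhysics.QuantumFieldTheory.Balaban1983to89.T3AlphaInputsACSchemas
open Literature.MathematicalPhysics.QuantumFieldTheory.Balaban1983to89.B10Eq38TorusDomains (toFine)
open Literature.MathematicalPhysics.QuantumFieldTheory.Balaban1983to89.T3RestrictedUnitDensity (resDensity integrable_resDensity)
open Literature.MathematicalPhysics.QuantumFieldTheory.Balaban1983to89.Missing (partitionFn measurable_plaqHol)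
open Summit.QuantumFields.Balaban3D.Carriers (suGroupModel)
open Summit.QuantumFields.Balaban3D.Proofs.Primitives (AlphaConsts)
open Summit.QuantumFields.YangMills.Theorems
open Summit.QuantumFields.YangMills.Theorems.HistoryTailDensityTransfer (gibbsK_real_preimage_iter_eq)
open Summit.QuantumFields.YangMills.Theorems.HistoryTailSandwich (partitionFn_eq_integral_resDensity)
open Summit.QuantumFields.YangMills.Theorems.HistoryTailMechanismA (integral_mul_indicator_one_eq_setIntegral)
open Summit.QuantumFields.YangMills.Theorems.HistoryTailAlphaConsumer (setIntegral_div_integral_le_ae)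

namespace Summit.QuantumFields.YangMills.Cruxes.HistoryTailL.BirthV5p6pre

open Classical

/-! ## §1 Registered stubs (sorries live ONLY here) -/

/-- STUB 2′ (XXL; OWNER RULING g17-№1 §C / g17-№2 (2); IN PRINT modulo Bałaban CMP 95–99/102 = NODE O's object at d = 3, run with the power-counting
profile as a PARAMETER) — BAŁABAN'S (α) INPUT ROWS HOLD FOR THE PINNED CARRIER AT EVERY SUFFICIENTLY LARGE PROFILE: for every admissible block size there are
thresholds `(b₁, p₁)` such that every profile `(b₀, p₀) ⪰ (b₁, p₁)` is the profile of SOME primitive-constants record `𝔠 : AlphaConsts L 2` (`𝔠.b₀ = b₀`,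
`𝔠.p₀ = p₀`) with [7]-constants `a₀ a₁` bound with the record, whose v2 AC (α) rows `AlphaInputsT3AC.OfV2At F 𝔠 a₀ a₁` hold for every family with `F.L = L` —
★alpha-1's LANDED closed Prop `Theorems.AlphaInputsT3ACv2Rec L` (p481577) BY NAME.  SHARED verbatim with the `FluctuationComparisonRegPrL` (stmt-QuantumFields-19935)
skeleton v5h. [cite: Balaban1985UV3, Thm 1 p.257, (7) p.257 and Thm 2 p.272] -/
theorem stub_laneRecords :
    ∀ (L : ℕ), Odd L → 1 < L → Summit.QuantumFields.YangMills.Theorems.AlphaInputsT3ACv2Rec L := by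
  sorry

/-- STUB 2″ (XL; the α-adapter of v5p at the record's OWN constants — OWNER RULING g17-№2 (2) / №3 ADDENDUM — re-typed as the lane's FLOOR-INDEPENDENT
deliverables at its CONCRETE v2 datum `OfV2At.dataT3c` / `lfDataT3c`): below a threshold `γ₂(L, 𝔠, a₀, a₁)` and with constants `CP, κZ` fixed with the record:
(a) `LargePSpec` — the large-field plaquettes of a region history lie in its regions `Λ_i` and are datum-large for the composite minimiser ((67) p.273);
(b) `SmallFactor71` — (70)–(71) p.273 for the composite minimiser; (c) `PintSize` at `CP` ((46) p.267); (d) `0 ≤ Zterm_j(h) ≤ κZ·Σ_{i<j} x_i·|Z_i(h)|`, `Z_i`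
counted in level-`i` sites ((41) p.266).  None of (a)–(d) reads the history WEIGHTS, so they are insensitive to the trivial-mass floor (F-α1-3) and transfer
verbatim to the windowed datum. [cite: Balaban1985UV3, (41) p.266, (46) p.267 and (67)-(71) p.273] -/
theorem stub_alphaOfLaneFull :
    ∀ (L : ℕ), Odd L → 1 < L →
      ∀ (𝔠 : AlphaConsts L (suGroupModel 2).N) (a₀ a₁ : ℝ), 0 < a₀ → 0 < a₁ → 𝔠.B₃ * a₁ ≤ a₀ →
        ∃ (γ₂ CP κZ : ℝ), 0 < γ₂ ∧ 0 ≤ CP ∧ 0 ≤ κZ ∧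
          ∀ (F : T3Family) (hF : F.L = L) (h : AlphaInputsT3AC.OfV2At F (hF ▸ 𝔠) a₀ a₁)
            (hc : 0 < a₀ ∧ 0 < a₁ ∧ (hF ▸ 𝔠).B₃ * a₁ ≤ a₀) (γ : ℝ) (hγ : 0 < γ) (hγ1 : γ ≤ (min (hF ▸ 𝔠).gamma0 1) ^ 2)
            (π : AlphaInputsT3AC.PolymerT3 F), γ ≤ γ₂ →
            LargePSpec (h.dataT3c hc γ hγ hγ1 π) (h.lfDataT3c hc γ hγ hγ1 π) (hF ▸ 𝔠).b₀ (hF ▸ 𝔠).p₀ ∧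
            SmallFactor71 (h.dataT3c hc γ hγ hγ1 π) (h.lfDataT3c hc γ hγ hγ1 π) (hF ▸ 𝔠).b₀ (hF ▸ 𝔠).p₀ ∧
            PintSize (h.dataT3c hc γ hγ hγ1 π) (hF ▸ 𝔠).b₀ (hF ▸ 𝔠).p₀ CP ∧
            (∀ (K j : ℕ) (r : (h.lfDataT3c hc γ hγ hγ1 π).Reg K j) (v : (i : Fin j) → GaugeField (F.P K) i (Matrix.specialUnitaryGroup (Fin 2) ℂ)),
              j ≤ K →
                0 ≤ (h.dataT3c hc γ hγ hγ1 π).Zterm K j ((h.lfDataT3c hc γ hγ hγ1 π).assemble K j r v) ∧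
                (h.dataT3c hc γ hγ hγ1 π).Zterm K j ((h.lfDataT3c hc γ hγ hγ1 π).assemble K j r v) ≤
                  κZ * ∑ i ∈ Finset.range j,
                    (1 + Real.log (Real.sqrt (γ * ((F.L : ℝ)⁻¹) ^ (K - i)))⁻¹) *
                      (({y : Site (F.P K) i | toFine i y ∉ (h.dataT3c hc γ hγ hγ1 π).Ω K j
                          ((h.lfDataT3c hc γ hγ hγ1 π).assemble K j r v) (i + 1)} : Set (Site (F.P K) i)).ncard : ℝ)) := by
  sorry

/-- STUB 2‴ (v5p6-pre: RESTATED IN THE v3-BUNDLE SHAPE — threshold-free, `Bm = 1`, (w2) POINTWISE for `1 ≤ j ≤ K`; = alpha-1's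
`AlphaInputsT3AC.windowedWeights_of_v3rows` (p506614) WITHOUT its rows hypothesis and with the weight family existential; at the v3 re-base this stub's body
becomes `⟨_, OfV3At.windowedWeights …⟩` and it stops being a stub) — **THE WINDOWED WEIGHTS** of ALL region histories of the concrete datum (whose regions,
minimiser, `mainT`, `Pint`, `Zterm`, `χ`, `low`, `Rm`, `LargeP` it keeps): (w0) `wt′ ≥ 0`; (w1) `wt′ = 0` on inadmissible histories; (w2) at levels `1 ≤ j ≤ K` a
non-zero weight charges an admissible pair, for EVERY field (print (40) p.266 «χ_j, j = 1, …, k»; no window at level 0, F-α1-9); (e′) integrable with `∫ wt′ ≤ 1`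
(K-uniform; print's masses); (e″) the interaction `Pint_j(r, ·)` measurable; (iv) the upper inductive inequality (41′) a.e. + integrability for the majorant assembled from
`wt′` — the datum `dataT3c` with `LF` replaced (structure update inline).  On the v2 package this is NOT derivable (F-α1-10/11, P-g18-1); it is print's (55)·(57) content,
delivered by the v3 socket. [cite: Balaban1985UV3, (40)-(41) p.266, (47) p.267 and (55) p.269] -/
theorem stub_windowedWeights :
    ∀ (L : ℕ), Odd L → 1 < L →
      ∀ (𝔠 : AlphaConsts L (suGroupModel 2).N) (a₀ a₁ : ℝ), 0 < a₀ → 0 < a₁ → 𝔠.B₃ * a₁ ≤ a₀ →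
          ∀ (F : T3Family) (hF : F.L = L) (h : AlphaInputsT3AC.OfV2At F (hF ▸ 𝔠) a₀ a₁)
            (hc : 0 < a₀ ∧ 0 < a₁ ∧ (hF ▸ 𝔠).B₃ * a₁ ≤ a₀) (γ : ℝ) (hγ : 0 < γ) (hγ1 : γ ≤ (min (hF ▸ 𝔠).gamma0 1) ^ 2)
            (π : AlphaInputsT3AC.PolymerT3 F),
            ∃ wt' : (K j : ℕ) → Summit.QuantumFields.Balaban3D.Carriers.Hist (F.P K) j → GaugeField (F.P K) j (Matrix.specialUnitaryGroup (Fin 2) ℂ) → ℝ,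
              (∀ K j r Wf, 0 ≤ wt' K j r Wf) ∧
              (∀ (K j : ℕ) (r : Summit.QuantumFields.Balaban3D.Carriers.Hist (F.P K) j) Wf,
                ¬ Summit.QuantumFields.Balaban3D.Carriers.Hist.Admissible (hF ▸ 𝔠).lane.carrier.M₁
                  (Summit.QuantumFields.Balaban3D.Carriers.rcolOf (T3Scales F γ hγ (hγ1.trans (sq_min_one_le _ (hF ▸ 𝔠).gamma0_pos)) K)
                    (hF ▸ 𝔠).lane.carrier) j r →
                wt' K j r Wf = 0) ∧
              (∀ (K j : ℕ) (r : Summit.QuantumFields.Balaban3D.Carriers.Hist (F.P K) j), 1 ≤ j → j ≤ K →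
                ∀ Wf : GaugeField (F.P K) j (Matrix.specialUnitaryGroup (Fin 2) ℂ),
                  wt' K j r Wf ≠ 0 → (h.dataT3c hc γ hγ hγ1 π).Adm K j r Wf) ∧
              (∀ (K j : ℕ) (r : Summit.QuantumFields.Balaban3D.Carriers.Hist (F.P K) j),
                Integrable (wt' K j r) (fieldMeasure (F.P K) j (Matrix.specialUnitaryGroup (Fin 2) ℂ)) ∧
                ∫ Wf, wt' K j r Wf ∂fieldMeasure (F.P K) j (Matrix.specialUnitaryGroup (Fin 2) ℂ) ≤ 1) ∧
              (∀ (K j : ℕ) (r : Summit.QuantumFields.Balaban3D.Carriers.Hist (F.P K) j), j ≤ K →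
                Measurable fun Wf : GaugeField (F.P K) j (Matrix.specialUnitaryGroup (Fin 2) ℂ) => (h.dataT3c hc γ hγ hγ1 π).Pint K j r Wf) ∧
              (∀ (K j : ℕ), j ≤ K →
                Ineq41AE ({ h.dataT3c hc γ hγ hγ1 π with
                    LF := fun K j Wf Φ => wt' K j (Summit.QuantumFields.Balaban3D.Carriers.Hist.triv (F.P K) j) Wf *
                        Real.exp (Φ (Summit.QuantumFields.Balaban3D.Carriers.Hist.triv (F.P K) j)) +
                      ∑ r ∈ Finset.univ.erase (Summit.QuantumFields.Balaban3D.Carriers.Hist.triv (F.P K) j),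
                        wt' K j r Wf * Real.exp (Φ r) } : AlphaDataT3 F γ) K j ∧
                Integrable (AlphaDataT3.up ({ h.dataT3c hc γ hγ hγ1 π with
                    LF := fun K j Wf Φ => wt' K j (Summit.QuantumFields.Balaban3D.Carriers.Hist.triv (F.P K) j) Wf *
                        Real.exp (Φ (Summit.QuantumFields.Balaban3D.Carriers.Hist.triv (F.P K) j)) +
                      ∑ r ∈ Finset.univ.erase (Summit.QuantumFields.Balaban3D.Carriers.Hist.triv (F.P K) j),
                        wt' K j r Wf * Real.exp (Φ r) } : AlphaDataT3 F γ) K j)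
                  (fieldMeasure (F.P K) j (Matrix.specialUnitaryGroup (Fin 2) ℂ))) := by
  sorry

/-- STUB 4c (L; DETERMINISTIC — no measure, no weights; lead finding F-g3-1 §3, OWNER RULING g17-№2 (1)) — **THE DILUTE-FAMILY EXPONENT BOUND FOR THE CONCRETE
DATUM**: given the size `κZ` of the large-field term, there are a separation constant `ccol ≥ 1` and a threshold `γc` such that for every admissible pair `(h, W)`
of the concrete datum, every level `j ≤ K` and every finite family `S` of `θBal(K−j)`-large plaquettes of `W` pairwise `ccol·x_j^{r₀}` apart (level-`j` `ℓ¹` units):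
`|S|·¼p_j² + Σ_{i<j} #P_i(h)·σ(i,j) ≤ mainT_j(h,W) − Zterm_j(h)`, `σ(i,j) = (b₀²/200)·x_i^{2p₀−1}·(x_i − x_j)`, `x_i = 1 + log(√(γL^{−(K−i)}))⁻¹`, `p_j = pFun b₀ p₀ g_{K−j}`.
(71) p.273 for every member — deep ones from the constraint (42) + (68) (`HistoryTailAlphaTopFamily`, p477621), the others from the CLUSTER of the history's own
large-field plaquettes near them (SmallFactor71, LargePSpec, the collar towers `HistoryTailTowerReach`, p484215; a level-`i` cluster of `n` plaquettes certifies
`max(1, n/12)·¼p_i²` and serves `≤ max(1, n/12)` members) — with the surplus `¼(p_i² − p_j²) ≥ ¼b₀²x_i^{2p₀−1}(x_i − x_j)` paying `σ` and the towers' `Zterm`; possible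
exactly because `2p₀ − 2 − 3r₀ = r₀ > 0` (`𝔠.p₀ = 2𝔠.r₀ + 1`). [cite: Balaban1985UV3, (41)-(42) p.266, (67)-(71) p.273] -/
theorem stub_diluteExponent :
    ∀ (L : ℕ), Odd L → 1 < L →
      ∀ (𝔠 : AlphaConsts L (suGroupModel 2).N) (a₀ a₁ : ℝ), 0 < a₀ → 0 < a₁ → 𝔠.B₃ * a₁ ≤ a₀ →
        ∀ (κZ : ℝ), 0 ≤ κZ → ∃ (ccol γc : ℝ), 1 ≤ ccol ∧ 0 < γc ∧
          ∀ (F : T3Family) (hF : F.L = L) (h : AlphaInputsT3AC.OfV2At F (hF ▸ 𝔠) a₀ a₁)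
            (hc : 0 < a₀ ∧ 0 < a₁ ∧ (hF ▸ 𝔠).B₃ * a₁ ≤ a₀) (γ : ℝ) (hγ : 0 < γ) (hγ1 : γ ≤ (min (hF ▸ 𝔠).gamma0 1) ^ 2)
            (π : AlphaInputsT3AC.PolymerT3 F), γ ≤ γc →
            LargePSpec (h.dataT3c hc γ hγ hγ1 π) (h.lfDataT3c hc γ hγ hγ1 π) (hF ▸ 𝔠).b₀ (hF ▸ 𝔠).p₀ →
            SmallFactor71 (h.dataT3c hc γ hγ hγ1 π) (h.lfDataT3c hc γ hγ hγ1 π) (hF ▸ 𝔠).b₀ (hF ▸ 𝔠).p₀ →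
            (∀ (K j : ℕ) (r : (h.lfDataT3c hc γ hγ hγ1 π).Reg K j) (v : (i : Fin j) → GaugeField (F.P K) i (Matrix.specialUnitaryGroup (Fin 2) ℂ)),
              j ≤ K →
                0 ≤ (h.dataT3c hc γ hγ hγ1 π).Zterm K j ((h.lfDataT3c hc γ hγ hγ1 π).assemble K j r v) ∧
                (h.dataT3c hc γ hγ hγ1 π).Zterm K j ((h.lfDataT3c hc γ hγ hγ1 π).assemble K j r v) ≤
                  κZ * ∑ i ∈ Finset.range j,
                    (1 + Real.log (Real.sqrt (γ * ((F.L : ℝ)⁻¹) ^ (K - i)))⁻¹) *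
                      (({y : Site (F.P K) i | toFine i y ∉ (h.dataT3c hc γ hγ hγ1 π).Ω K j
                          ((h.lfDataT3c hc γ hγ hγ1 π).assemble K j r v) (i + 1)} : Set (Site (F.P K) i)).ncard : ℝ)) →
            ∀ (K j : ℕ), j ≤ K →
              ∀ (r : (h.lfDataT3c hc γ hγ hγ1 π).Reg K j) (v : (i : Fin j) → GaugeField (F.P K) i (Matrix.specialUnitaryGroup (Fin 2) ℂ))
                (Wf : GaugeField (F.P K) j (Matrix.specialUnitaryGroup (Fin 2) ℂ)),
                (h.dataT3c hc γ hγ hγ1 π).Adm K j ((h.lfDataT3c hc γ hγ hγ1 π).assemble K j r v) Wf →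
                ∀ S : Finset (Plaq (F.P K) j),
                  (∀ q ∈ S, θBal F.L γ (hF ▸ 𝔠).b₀ (hF ▸ 𝔠).p₀ (K - j) ≤ GaugeGroup.dist1 (GaugeField.plaqHol Wf q)) →
                  (∀ q ∈ S, ∀ q' ∈ S, q ≠ q' →
                    ccol * (1 + Real.log (Real.sqrt (γ * ((F.L : ℝ)⁻¹) ^ (K - j)))⁻¹) ^ (hF ▸ 𝔠).r₀ ≤ (Site.tdist q.src q'.src : ℝ)) →
                  (S.card : ℝ) * (B10.pFun (hF ▸ 𝔠).b₀ (hF ▸ 𝔠).p₀ (Real.sqrt (γ * ((F.L : ℝ)⁻¹) ^ (K - j))) ^ 2 / 4) +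
                      ∑ i ∈ Finset.range j, (((h.lfDataT3c hc γ hγ hγ1 π).LargeP K j r i).card : ℝ) *
                        ((hF ▸ 𝔠).b₀ ^ 2 / 200 *
                          (1 + Real.log (Real.sqrt (γ * ((F.L : ℝ)⁻¹) ^ (K - i)))⁻¹) ^ (2 * (hF ▸ 𝔠).p₀ - 1) *
                          ((1 + Real.log (Real.sqrt (γ * ((F.L : ℝ)⁻¹) ^ (K - i)))⁻¹) -
                            (1 + Real.log (Real.sqrt (γ * ((F.L : ℝ)⁻¹) ^ (K - j)))⁻¹))) ≤
                    (h.dataT3c hc γ hγ hγ1 π).mainT K j ((h.lfDataT3c hc γ hγ hγ1 π).assemble K j r v) Wf -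
                      (h.dataT3c hc γ hγ hγ1 π).Zterm K j ((h.lfDataT3c hc γ hγ hγ1 π).assemble K j r v) := by
  exact Summit.QuantumFields.YangMills.Theorems.HistoryTailDiluteExponent.diluteExponent_of_one_lt

/-- STUB 4b (M; [Balaban1985UV3] the lower half of Thm 1 (5) p.256 «χ_k exp[−(1/g_k²)A^η(U_k) − c|T₁^{(k)}|] ≤ ρ_k» integrated over the small-field window, (47) p.267,
(66) p.273) — **THE MASS OF THE (47)-MINORANT OF THE CONCRETE DATUM**: given `CP` there are `CL, γb` such that for `γ ≤ γb` and `j ≤ K`,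
`exp(−CL·x_j·N_j³) ≤ ∫ low_D dW` — `χ_j` is the indicator of the route's window (`dataT3c_chi_eq`), `mainT(triv, W) = β_K·minActionRegPr ≤` the action of a smooth
competitor `≤ c·N_j³` on the `g_{K−j}`-window (19200's lift), `|Pint(triv)| ≤ CP·θ²N³`, and the Haar volume of the window is `≥ (c·g³)^{3N_j³} = e^{−9x_jN_j³ − c′N_j³}`.
[cite: Balaban1985UV3, (5) p.256, (47) p.267 and (66) p.273] -/
theorem stub_lowMass :
    ∀ (L : ℕ), Odd L → 1 < L →
      ∀ (𝔠 : AlphaConsts L (suGroupModel 2).N) (a₀ a₁ : ℝ), 0 < a₀ → 0 < a₁ → 𝔠.B₃ * a₁ ≤ a₀ →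
        ∀ (CP : ℝ), 0 ≤ CP → ∃ (CL γb : ℝ), 0 ≤ CL ∧ 0 < γb ∧
          ∀ (F : T3Family) (hF : F.L = L) (h : AlphaInputsT3AC.OfV2At F (hF ▸ 𝔠) a₀ a₁)
            (hc : 0 < a₀ ∧ 0 < a₁ ∧ (hF ▸ 𝔠).B₃ * a₁ ≤ a₀) (γ : ℝ) (hγ : 0 < γ) (hγ1 : γ ≤ (min (hF ▸ 𝔠).gamma0 1) ^ 2)
            (π : AlphaInputsT3AC.PolymerT3 F), γ ≤ γb →
            PintSize (h.dataT3c hc γ hγ hγ1 π) (hF ▸ 𝔠).b₀ (hF ▸ 𝔠).p₀ CP →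
            ∀ (K j : ℕ), j ≤ K →
              Real.exp (-(CL * (1 + Real.log (Real.sqrt (γ * ((F.L : ℝ)⁻¹) ^ (K - j)))⁻¹) * ((F.P K).sitesPerDir j : ℝ) ^ 3)) ≤
                ∫ Wf, (h.dataT3c hc γ hγ hγ1 π).low K j Wf ∂fieldMeasure (F.P K) j (Matrix.specialUnitaryGroup (Fin 2) ℂ) := by
  exact Summit.QuantumFields.YangMills.Theorems.HistoryTailLowMass.stub_lowMass_of_one_lt

/-! ## §2 The composition — NO sorry below this line -/

/-- ADAPTER (v5p6-pre): STUB 2‴ in the v3-BUNDLE SHAPE (threshold-free, `Bm = 1`, (w2) POINTWISE for `1 ≤ j ≤ K` — the shape of alpha-1's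
`AlphaInputsT3AC.windowedWeights_of_v3rows` / the v3 theorem `OfV3At.windowedWeights`) implies v5p5's shape (`γw := 1`, `Bm := 1`, (w2) a.e.), which the
composition below consumes unchanged. [folklore] -/
theorem windowedWeights_v5p5Shape :
    ∀ (L : ℕ), Odd L → 1 < L →
      ∀ (𝔠 : AlphaConsts L (suGroupModel 2).N) (a₀ a₁ : ℝ), 0 < a₀ → 0 < a₁ → 𝔠.B₃ * a₁ ≤ a₀ →
        ∃ (γw Bm : ℝ), 0 < γw ∧ 0 ≤ Bm ∧
          ∀ (F : T3Family) (hF : F.L = L) (h : AlphaInputsT3AC.OfV2At F (hF ▸ 𝔠) a₀ a₁)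
            (hc : 0 < a₀ ∧ 0 < a₁ ∧ (hF ▸ 𝔠).B₃ * a₁ ≤ a₀) (γ : ℝ) (hγ : 0 < γ) (hγ1 : γ ≤ (min (hF ▸ 𝔠).gamma0 1) ^ 2)
            (π : AlphaInputsT3AC.PolymerT3 F), γ ≤ γw →
            ∃ wt' : (K j : ℕ) → Summit.QuantumFields.Balaban3D.Carriers.Hist (F.P K) j → GaugeField (F.P K) j (Matrix.specialUnitaryGroup (Fin 2) ℂ) → ℝ,
              (∀ K j r Wf, 0 ≤ wt' K j r Wf) ∧
              (∀ (K j : ℕ) (r : Summit.QuantumFields.Balaban3D.Carriers.Hist (F.P K) j) Wf,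
                ¬ Summit.QuantumFields.Balaban3D.Carriers.Hist.Admissible (hF ▸ 𝔠).lane.carrier.M₁
                  (Summit.QuantumFields.Balaban3D.Carriers.rcolOf (T3Scales F γ hγ (hγ1.trans (sq_min_one_le _ (hF ▸ 𝔠).gamma0_pos)) K)
                    (hF ▸ 𝔠).lane.carrier) j r →
                wt' K j r Wf = 0) ∧
              (∀ (K j : ℕ) (r : Summit.QuantumFields.Balaban3D.Carriers.Hist (F.P K) j), j ≤ K → 1 ≤ j →
                ∀ᵐ Wf ∂fieldMeasure (F.P K) j (Matrix.specialUnitaryGroup (Fin 2) ℂ),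
                  wt' K j r Wf ≠ 0 → (h.dataT3c hc γ hγ hγ1 π).Adm K j r Wf) ∧
              (∀ (K j : ℕ) (r : Summit.QuantumFields.Balaban3D.Carriers.Hist (F.P K) j), j ≤ K →
                Integrable (wt' K j r) (fieldMeasure (F.P K) j (Matrix.specialUnitaryGroup (Fin 2) ℂ)) ∧
                ∫ Wf, wt' K j r Wf ∂fieldMeasure (F.P K) j (Matrix.specialUnitaryGroup (Fin 2) ℂ) ≤ Bm) ∧
              (∀ (K j : ℕ) (r : Summit.QuantumFields.Balaban3D.Carriers.Hist (F.P K) j), j ≤ K →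
                Measurable fun Wf : GaugeField (F.P K) j (Matrix.specialUnitaryGroup (Fin 2) ℂ) => (h.dataT3c hc γ hγ hγ1 π).Pint K j r Wf) ∧
              (∀ (K j : ℕ), j ≤ K →
                Ineq41AE ({ h.dataT3c hc γ hγ hγ1 π with
                    LF := fun K j Wf Φ => wt' K j (Summit.QuantumFields.Balaban3D.Carriers.Hist.triv (F.P K) j) Wf *
                        Real.exp (Φ (Summit.QuantumFields.Balaban3D.Carriers.Hist.triv (F.P K) j)) +
                      ∑ r ∈ Finset.univ.erase (Summit.QuantumFields.Balaban3D.Carriers.Hist.triv (F.P K) j),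
                        wt' K j r Wf * Real.exp (Φ r) } : AlphaDataT3 F γ) K j ∧
                Integrable (AlphaDataT3.up ({ h.dataT3c hc γ hγ hγ1 π with
                    LF := fun K j Wf Φ => wt' K j (Summit.QuantumFields.Balaban3D.Carriers.Hist.triv (F.P K) j) Wf *
                        Real.exp (Φ (Summit.QuantumFields.Balaban3D.Carriers.Hist.triv (F.P K) j)) +
                      ∑ r ∈ Finset.univ.erase (Summit.QuantumFields.Balaban3D.Carriers.Hist.triv (F.P K) j),
                        wt' K j r Wf * Real.exp (Φ r) } : AlphaDataT3 F γ) K j)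
                  (fieldMeasure (F.P K) j (Matrix.specialUnitaryGroup (Fin 2) ℂ))) := by
  intro L hLo hL 𝔠 a₀ a₁ ha0 ha1 hw
  refine ⟨1, 1, one_pos, zero_le_one, fun F hF h hc γ hγ hγ1 π _ => ?_⟩
  obtain ⟨wt', h0, h1, h2, h3, h4, h5⟩ := stub_windowedWeights L hLo hL 𝔠 a₀ a₁ ha0 ha1 hw F hF h hc γ hγ hγ1 π
  exact ⟨wt', h0, h1, fun K j r hjK hj1 => ae_of_all _ (h2 K j r hj1 hjK), fun K j r _ => h3 K j r, h4, h5⟩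

/-- **MECHANISM A ON A JOINT LARGE-PLAQUETTE EVENT, FROM THE FOUR ENVELOPE CLAUSES** (re-cut of `HistoryTailAlphaConsumer.gibbsK_real_largePlaquette_le_of_alphaInputs`
/ v5p's `gibbsK_real_iInter_le_of_alphaInputs` to the clauses actually used, all DELIVERED for the concrete datum): (41′)/(47′) a.e., regular envelopes, `low ≥ 0`,
and a numerator bound `∫_{E_S} up ≤ B·∫ low` give `Gibbs_K(⋂_{q∈S}{θ ≤ |Ū^j(∂q) − 1|}) ≤ e^{2Rm_j}·B`. [cite: Balaban1985UV3, (41) p.266 and (47) p.267] -/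
theorem gibbsK_real_iInter_le {F : T3Family} {γ : ℝ} (hγ : 0 ≤ γ) {D : AlphaDataT3 F γ} {K j : ℕ} (hjK : j ≤ K)
    (h41 : Ineq41AE D K j) (h47 : Ineq47AE D K j) (hreg : EnvelopeRegular D K j) (hlow0 : ∀ W, 0 ≤ D.low K j W)
    (S : Finset (Plaq (F.P K) j)) (θ B : ℝ)
    (hnum : ∫ W in {W | ∀ q ∈ S, θ ≤ GaugeGroup.dist1 (GaugeField.plaqHol W q)}, D.up K j W
        ∂fieldMeasure (F.P K) j (Matrix.specialUnitaryGroup (Fin 2) ℂ) ≤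
      B * ∫ W, D.low K j W ∂fieldMeasure (F.P K) j (Matrix.specialUnitaryGroup (Fin 2) ℂ)) :
    (gibbsK F ℰp γ K).real
        {U | ∀ q ∈ S, θ ≤ GaugeGroup.dist1 (GaugeField.plaqHol
          (Averaging.iter (fun _ => BlockAveraging.blockAvg ℰp) j U) q)} ≤
      Real.exp (2 * D.Rm K j) * B := by
  have hj : j ≤ F.m + K := hjK.trans (Nat.le_add_left K F.m)
  have hEeq : {W : GaugeField (F.P K) j (Matrix.specialUnitaryGroup (Fin 2) ℂ) |
        ∀ q ∈ S, θ ≤ GaugeGroup.dist1 (GaugeField.plaqHol W q)} =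
      ⋂ q ∈ S, {W | θ ≤ GaugeGroup.dist1 (GaugeField.plaqHol W q)} := by
    ext W; simp
  have hE : MeasurableSet {W : GaugeField (F.P K) j (Matrix.specialUnitaryGroup (Fin 2) ℂ) |
      ∀ q ∈ S, θ ≤ GaugeGroup.dist1 (GaugeField.plaqHol W q)} := by
    rw [hEeq]
    exact S.measurableSet_biInter fun q _ =>
      measurableSet_le measurable_const (RegularGaugeGroup.measurable_dist1.comp (measurable_plaqHol q))
  have hset : {U : GaugeField (F.P K) 0 (Matrix.specialUnitaryGroup (Fin 2) ℂ) |
        ∀ q ∈ S, θ ≤ GaugeGroup.dist1 (GaugeField.plaqHol (Averaging.iter (fun _ => BlockAveraging.blockAvg ℰp) j U) q)} =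
      (fun U => Averaging.iter (fun _ => BlockAveraging.blockAvg ℰp) j U) ⁻¹'
        {W | ∀ q ∈ S, θ ≤ GaugeGroup.dist1 (GaugeField.plaqHol W q)} := rfl
  rw [hset, gibbsK_real_preimage_iter_eq F hγ hj hE, partitionFn_eq_integral_resDensity F hγ hj,
    integral_mul_indicator_one_eq_setIntegral _ hE]
  exact setIntegral_div_integral_le_ae _ _ _ (D.up K j) (D.low K j) (D.Ecst K j) (D.Rm K j) B
    h41 h47 hlow0 (integrable_resDensity F K MeasurableSet.univ hγ hj) (integrableOn_up hreg _) hreg.1 hreg.2.2 hnum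

/-- **THE |S|-TH ROOT ARITHMETIC** (v5p): `a ≤ b^{1/n}`, `b ≤ CRm·e^{E}`, `n ≥ 1` ⇒ `a ≤ max(1, CRm)·e^{E/n}`. [folklore] -/
theorem root_bound {a b CRm E : ℝ} {n : ℕ} (hn : 1 ≤ n) (hb0 : 0 ≤ b) (hCRm : 0 ≤ CRm)
    (hab : a ≤ b ^ ((1 : ℝ) / (n : ℝ))) (hb : b ≤ CRm * Real.exp E) : a ≤ max 1 CRm * Real.exp (E / n) := by
  have hn0 : (0 : ℝ) < n := by exact_mod_cast hn
  have hexp : 0 ≤ (1 : ℝ) / (n : ℝ) := by positivity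
  have h1 : b ^ ((1 : ℝ) / (n : ℝ)) ≤ (CRm * Real.exp E) ^ ((1 : ℝ) / (n : ℝ)) := Real.rpow_le_rpow hb0 hb hexp
  have h2 : (CRm * Real.exp E) ^ ((1 : ℝ) / (n : ℝ)) = CRm ^ ((1 : ℝ) / (n : ℝ)) * Real.exp (E / n) := by
    rw [Real.mul_rpow hCRm (Real.exp_pos _).le, ← Real.exp_mul]
    congr 2
    field_simp
  have h3 : CRm ^ ((1 : ℝ) / (n : ℝ)) ≤ max 1 CRm := by
    by_cases hC1 : CRm ≤ 1
    · exact (Real.rpow_le_one hCRm hC1 hexp).trans (le_max_left _ _)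
    · have hC1' : 1 ≤ CRm := (not_le.mp hC1).le
      have hle : (1 : ℝ) / (n : ℝ) ≤ 1 := by
        rw [div_le_one hn0]; exact_mod_cast hn
      calc CRm ^ ((1 : ℝ) / (n : ℝ)) ≤ CRm ^ (1 : ℝ) := Real.rpow_le_rpow_of_exponent_le hC1' hle
        _ = CRm := Real.rpow_one _
        _ ≤ max 1 CRm := le_max_right _ _
  calc a ≤ b ^ ((1 : ℝ) / (n : ℝ)) := hab
    _ ≤ CRm ^ ((1 : ℝ) / (n : ℝ)) * Real.exp (E / n) := h1.trans_eq h2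
    _ ≤ max 1 CRm * Real.exp (E / n) := mul_le_mul_of_nonneg_right h3 (Real.exp_nonneg _)

/-- **THE EXPONENT BOOKKEEPING** (v5p): with `x ≥ 1`, `ρ = ccol·x^{r₀}` (`ccol ≥ 1`, `r₀ ≥ 0`), `T ≤ n·8(L(ρ+4))³` and `C ≥ 0`:
`(−¼P·n + C·x·T)/n ≤ −¼P + κ·x^{2+3r₀}` with `κ = 8CL³(ccol+4)³`. [folklore] -/
theorem exponent_bound {P4 C x L ccol r₀ T : ℝ} {n : ℕ} (hn : 1 ≤ n) (hC : 0 ≤ C) (hx : 1 ≤ x) (hL : 0 ≤ L)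
    (hccol : 1 ≤ ccol) (hr₀ : 0 ≤ r₀) (hT : T ≤ (n : ℝ) * (8 * (L * (ccol * x ^ r₀ + 4)) ^ 3)) :
    (-P4 * (n : ℝ) + C * x * T) / n ≤ -P4 + 8 * C * L ^ 3 * (ccol + 4) ^ 3 * x ^ (2 + 3 * r₀) := by
  have hn0 : (0 : ℝ) < n := by exact_mod_cast hn
  have hx0 : 0 < x := lt_of_lt_of_le one_pos hx
  have hxr : 1 ≤ x ^ r₀ := Real.one_le_rpow hx hr₀
  have hxr0 : 0 ≤ x ^ r₀ := le_trans zero_le_one hxr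
  have hρ : ccol * x ^ r₀ + 4 ≤ (ccol + 4) * x ^ r₀ := by nlinarith
  have hρ0 : 0 ≤ ccol * x ^ r₀ + 4 := by positivity
  have hcube : (L * (ccol * x ^ r₀ + 4)) ^ 3 ≤ (L * ((ccol + 4) * x ^ r₀)) ^ 3 :=
    pow_le_pow_left₀ (mul_nonneg hL hρ0) (mul_le_mul_of_nonneg_left hρ hL) 3
  have hpow3 : (x ^ r₀) ^ 3 = x ^ (3 * r₀) := by
    rw [← Real.rpow_natCast, ← Real.rpow_mul hx0.le]; norm_num; ring_nf
  have hx13 : x * x ^ (3 * r₀) = x ^ (1 + 3 * r₀) := by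
    rw [Real.rpow_add hx0, Real.rpow_one]
  have hx23 : x ^ (1 + 3 * r₀) ≤ x ^ (2 + 3 * r₀) := Real.rpow_le_rpow_of_exponent_le hx (by linarith)
  have hdiv : (-P4 * (n : ℝ) + C * x * T) / n = -P4 + C * x * (T / n) := by
    field_simp
  rw [hdiv]
  have hTn : T / n ≤ 8 * (L * (ccol * x ^ r₀ + 4)) ^ 3 := by
    rw [div_le_iff₀ hn0]; linarith
  have hCx : 0 ≤ C * x := mul_nonneg hC hx0.le
  calc -P4 + C * x * (T / n) ≤ -P4 + C * x * (8 * (L * ((ccol + 4) * x ^ r₀)) ^ 3) := by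
        have := mul_le_mul_of_nonneg_left (hTn.trans (mul_le_mul_of_nonneg_left hcube (by norm_num))) hCx
        linarith
    _ = -P4 + 8 * C * L ^ 3 * (ccol + 4) ^ 3 * (x * (x ^ r₀) ^ 3) := by ring
    _ = -P4 + 8 * C * L ^ 3 * (ccol + 4) ^ 3 * x ^ (1 + 3 * r₀) := by rw [hpow3, hx13]
    _ ≤ -P4 + 8 * C * L ^ 3 * (ccol + 4) ^ 3 * x ^ (2 + 3 * r₀) := by
        have hk : 0 ≤ 8 * C * L ^ 3 * (ccol + 4) ^ 3 := by positivity
        have := mul_le_mul_of_nonneg_left hx23 hk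
        linarith

/-! ### §2.1 The concrete datum with a windowed trivial weight: the numerator bound on a joint event -/

section Concrete

variable {F : T3Family} {𝔠 : AlphaConsts F.L (suGroupModel 2).N} {a₀ a₁ : ℝ}
  (h : AlphaInputsT3AC.OfV2At F 𝔠 a₀ a₁) (hc : 0 < a₀ ∧ 0 < a₁ ∧ 𝔠.B₃ * a₁ ≤ a₀) (γ : ℝ) (hγ : 0 < γ)
  (hγ1 : γ ≤ (min 𝔠.gamma0 1) ^ 2) (π : AlphaInputsT3AC.PolymerT3 F)

/-- **THE NUMERATOR BOUND ON A JOINT LARGE-PLAQUETTE EVENT FROM THE PIECES** (deterministic exponent bound 4c at this family, history mass 4a, a windowed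
trivial weight `wtT` with its mass bound, a.e. supports, interaction size): for a majorant `U(W) = wtT(W)·e^{Φ(triv,W)} + Σ_{r ≠ triv} m_j(r,W)·e^{Φ(r,W)}`,
`Φ(r,W) = −mainT + Pint + Zterm` of the concrete datum, `∫_{E_S} U ≤ e^{−|S|·P4}·(MA + e^{Pz}·MT)`. [cite: Balaban1985UV3, (41) p.266 and (71) p.273] -/
theorem setIntegral_up_le (K j : ℕ) (S : Finset (Plaq (F.P K) j)) (θ P4 MA MT Pz : ℝ) (σ : ℕ → ℝ) (hσ : ∀ i, i < j → 0 ≤ σ i)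
    (wt : Summit.QuantumFields.Balaban3D.Carriers.Hist (F.P K) j → GaugeField (F.P K) j (Matrix.specialUnitaryGroup (Fin 2) ℂ) → ℝ)
    (hwt0 : ∀ r Wf, 0 ≤ wt r Wf)
    (U wtT : GaugeField (F.P K) j (Matrix.specialUnitaryGroup (Fin 2) ℂ) → ℝ) (hwtT0 : ∀ Wf, 0 ≤ wtT Wf)
    (hU : ∀ Wf, U Wf = wtT Wf * Real.exp (-((h.dataT3c hc γ hγ hγ1 π).mainT K j (Summit.QuantumFields.Balaban3D.Carriers.Hist.triv (F.P K) j) Wf) +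
        (h.dataT3c hc γ hγ hγ1 π).Pint K j (Summit.QuantumFields.Balaban3D.Carriers.Hist.triv (F.P K) j) Wf +
        (h.dataT3c hc γ hγ hγ1 π).Zterm K j (Summit.QuantumFields.Balaban3D.Carriers.Hist.triv (F.P K) j)) +
      ∑ r ∈ Finset.univ.erase (Summit.QuantumFields.Balaban3D.Carriers.Hist.triv (F.P K) j),
        wt r Wf *
          Real.exp (-((h.dataT3c hc γ hγ hγ1 π).mainT K j r Wf) + (h.dataT3c hc γ hγ hγ1 π).Pint K j r Wf + (h.dataT3c hc γ hγ hγ1 π).Zterm K j r))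
    (h4c : ∀ (r : Summit.QuantumFields.Balaban3D.Carriers.Hist (F.P K) j) (Wf : GaugeField (F.P K) j (Matrix.specialUnitaryGroup (Fin 2) ℂ)),
      (h.dataT3c hc γ hγ hγ1 π).Adm K j r Wf → (∀ q ∈ S, θ ≤ GaugeGroup.dist1 (GaugeField.plaqHol Wf q)) →
        (S.card : ℝ) * P4 + ∑ i ∈ Finset.range j, (((h.lfDataT3c hc γ hγ hγ1 π).LargeP K j r i).card : ℝ) * σ i ≤
          (h.dataT3c hc γ hγ hγ1 π).mainT K j r Wf - (h.dataT3c hc γ hγ hγ1 π).Zterm K j r)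
    (hT1 : ∀ r : Summit.QuantumFields.Balaban3D.Carriers.Hist (F.P K) j, r ≠ Summit.QuantumFields.Balaban3D.Carriers.Hist.triv (F.P K) j →
      ∀ᵐ Wf ∂fieldMeasure (F.P K) j (Matrix.specialUnitaryGroup (Fin 2) ℂ),
        wt r Wf ≠ 0 → (h.dataT3c hc γ hγ hγ1 π).Adm K j r Wf)
    (hT1' : ∀ᵐ Wf ∂fieldMeasure (F.P K) j (Matrix.specialUnitaryGroup (Fin 2) ℂ),
      wtT Wf ≠ 0 → (h.dataT3c hc γ hγ hγ1 π).Adm K j (Summit.QuantumFields.Balaban3D.Carriers.Hist.triv (F.P K) j) Wf)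
    (hPint : ∀ (r : Summit.QuantumFields.Balaban3D.Carriers.Hist (F.P K) j) (Wf : GaugeField (F.P K) j (Matrix.specialUnitaryGroup (Fin 2) ℂ)),
      (h.dataT3c hc γ hγ hγ1 π).Adm K j r Wf → (h.dataT3c hc γ hγ hγ1 π).Pint K j r Wf ≤ Pz)
    (h4a : Integrable (fun Wf : GaugeField (F.P K) j (Matrix.specialUnitaryGroup (Fin 2) ℂ) =>
        ∑ r ∈ Finset.univ.erase (Summit.QuantumFields.Balaban3D.Carriers.Hist.triv (F.P K) j),
          wt r Wf *
            Real.exp ((h.dataT3c hc γ hγ hγ1 π).Pint K j r Wf -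
              ∑ i ∈ Finset.range j, (((h.lfDataT3c hc γ hγ hγ1 π).LargeP K j r i).card : ℝ) * σ i))
        (fieldMeasure (F.P K) j (Matrix.specialUnitaryGroup (Fin 2) ℂ)) ∧
      ∫ Wf, ∑ r ∈ Finset.univ.erase (Summit.QuantumFields.Balaban3D.Carriers.Hist.triv (F.P K) j),
          wt r Wf *
            Real.exp ((h.dataT3c hc γ hγ hγ1 π).Pint K j r Wf -
              ∑ i ∈ Finset.range j, (((h.lfDataT3c hc γ hγ hγ1 π).LargeP K j r i).card : ℝ) * σ i)
        ∂fieldMeasure (F.P K) j (Matrix.specialUnitaryGroup (Fin 2) ℂ) ≤ MA)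
    (hT2 : Integrable wtT (fieldMeasure (F.P K) j (Matrix.specialUnitaryGroup (Fin 2) ℂ)) ∧
      ∫ Wf, wtT Wf ∂fieldMeasure (F.P K) j (Matrix.specialUnitaryGroup (Fin 2) ℂ) ≤ MT)
    (hUI : Integrable U (fieldMeasure (F.P K) j (Matrix.specialUnitaryGroup (Fin 2) ℂ))) :
    ∫ Wf in {Wf | ∀ q ∈ S, θ ≤ GaugeGroup.dist1 (GaugeField.plaqHol Wf q)}, U Wf ∂fieldMeasure (F.P K) j (Matrix.specialUnitaryGroup (Fin 2) ℂ) ≤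
      Real.exp (-((S.card : ℝ) * P4)) * (MA + Real.exp Pz * MT) := by
  set D := h.dataT3c hc γ hγ hγ1 π with hD
  set W := h.lfDataT3c hc γ hγ hγ1 π with hW
  set μ := fieldMeasure (F.P K) j (Matrix.specialUnitaryGroup (Fin 2) ℂ) with hμ
  set triv := Summit.QuantumFields.Balaban3D.Carriers.Hist.triv (F.P K) j with htriv
  set E : Set (GaugeField (F.P K) j (Matrix.specialUnitaryGroup (Fin 2) ℂ)) :=
    {Wf | ∀ q ∈ S, θ ≤ GaugeGroup.dist1 (GaugeField.plaqHol Wf q)} with hE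
  set G : GaugeField (F.P K) j (Matrix.specialUnitaryGroup (Fin 2) ℂ) → ℝ := fun Wf =>
    ∑ r ∈ Finset.univ.erase triv, wt r Wf *
      Real.exp (D.Pint K j r Wf - ∑ i ∈ Finset.range j, ((W.LargeP K j r i).card : ℝ) * σ i) with hG
  set c : ℝ := (S.card : ℝ) * P4 with hcdef
  have hEm : MeasurableSet E := by
    have hEeq : E = ⋂ q ∈ S, {Wf | θ ≤ GaugeGroup.dist1 (GaugeField.plaqHol Wf q)} := by ext Wf; simp [hE]
    rw [hEeq]
    exact S.measurableSet_biInter fun q _ =>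
      measurableSet_le measurable_const (RegularGaugeGroup.measurable_dist1.comp (measurable_plaqHol q))
  -- a.e.: every non-trivial history with non-zero weight is admissible, and so is the windowed trivial one
  have hall : ∀ᵐ Wf ∂μ, ∀ r : Summit.QuantumFields.Balaban3D.Carriers.Hist (F.P K) j, r ≠ triv → wt r Wf ≠ 0 → D.Adm K j r Wf := by
    rw [ae_all_iff]; intro r
    by_cases hr : r = triv
    · exact ae_of_all _ fun Wf h' => absurd hr h'
    · filter_upwards [hT1 r hr] with Wf hWf _ using hWf
  -- the pointwise bound on `E`
  have hpt : ∀ᵐ Wf ∂μ, Wf ∈ E → U Wf ≤ Real.exp (-c) * (G Wf + Real.exp Pz * wtT Wf) := by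
    filter_upwards [hall, hT1'] with Wf hWf hWfT hWE
    rw [hU Wf]
    -- non-trivial terms
    have hterm : ∀ r, r ≠ triv → wt r Wf * Real.exp (-(D.mainT K j r Wf) + D.Pint K j r Wf + D.Zterm K j r) ≤
        Real.exp (-c) * (wt r Wf * Real.exp (D.Pint K j r Wf - ∑ i ∈ Finset.range j, ((W.LargeP K j r i).card : ℝ) * σ i)) := by
      intro r hr
      by_cases hw : wt r Wf = 0
      · rw [hw, zero_mul, zero_mul, mul_zero]
      · have hadm := hWf r hr hw
        have h4 := h4c r Wf hadm hWE
        have hexp : Real.exp (-(D.mainT K j r Wf) + D.Pint K j r Wf + D.Zterm K j r) ≤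
            Real.exp (-c) * Real.exp (D.Pint K j r Wf - ∑ i ∈ Finset.range j, ((W.LargeP K j r i).card : ℝ) * σ i) := by
          rw [← Real.exp_add]
          exact Real.exp_le_exp.mpr (by rw [hcdef]; linarith)
        calc wt r Wf * Real.exp (-(D.mainT K j r Wf) + D.Pint K j r Wf + D.Zterm K j r)
            ≤ wt r Wf * (Real.exp (-c) *
                Real.exp (D.Pint K j r Wf - ∑ i ∈ Finset.range j, ((W.LargeP K j r i).card : ℝ) * σ i)) :=
              mul_le_mul_of_nonneg_left hexp (hwt0 r Wf)
          _ = _ := by ring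
    -- the windowed trivial term: `Pint ≤ Pz`, `Σσ ≥ 0` (4c at the trivial history)
    have htrivterm : wtT Wf * Real.exp (-(D.mainT K j triv Wf) + D.Pint K j triv Wf + D.Zterm K j triv) ≤
        Real.exp (-c) * (Real.exp Pz * wtT Wf) := by
      by_cases hw : wtT Wf = 0
      · rw [hw, zero_mul, mul_zero, mul_zero]
      · have hadm := hWfT hw
        have h4 := h4c triv Wf hadm hWE
        have hsum0 : 0 ≤ ∑ i ∈ Finset.range j, ((W.LargeP K j triv i).card : ℝ) * σ i :=
          Finset.sum_nonneg fun i hi => mul_nonneg (Nat.cast_nonneg _) (hσ i (Finset.mem_range.mp hi))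
        have hP := hPint triv Wf hadm
        have hexp : Real.exp (-(D.mainT K j triv Wf) + D.Pint K j triv Wf + D.Zterm K j triv) ≤ Real.exp (-c) * Real.exp Pz := by
          rw [← Real.exp_add]
          exact Real.exp_le_exp.mpr (by rw [hcdef]; linarith)
        calc wtT Wf * Real.exp (-(D.mainT K j triv Wf) + D.Pint K j triv Wf + D.Zterm K j triv)
            ≤ wtT Wf * (Real.exp (-c) * Real.exp Pz) := mul_le_mul_of_nonneg_left hexp (hwtT0 Wf)
          _ = Real.exp (-c) * (Real.exp Pz * wtT Wf) := by ring
    have hrest : ∑ r ∈ Finset.univ.erase triv, wt r Wf * Real.exp (-(D.mainT K j r Wf) + D.Pint K j r Wf + D.Zterm K j r) ≤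
        Real.exp (-c) * G Wf := by
      rw [hG, Finset.mul_sum]
      exact Finset.sum_le_sum fun r hr => hterm r (Finset.ne_of_mem_erase hr)
    calc wtT Wf * Real.exp (-(D.mainT K j triv Wf) + D.Pint K j triv Wf + D.Zterm K j triv) +
          ∑ r ∈ Finset.univ.erase triv, wt r Wf * Real.exp (-(D.mainT K j r Wf) + D.Pint K j r Wf + D.Zterm K j r)
        ≤ Real.exp (-c) * (Real.exp Pz * wtT Wf) + Real.exp (-c) * G Wf := add_le_add htrivterm hrest
      _ = Real.exp (-c) * (G Wf + Real.exp Pz * wtT Wf) := by ring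
  -- integrate over `E`
  have hGI : Integrable G μ := h4a.1
  have hTI : Integrable wtT μ := hT2.1
  have hRI : Integrable (fun Wf => Real.exp (-c) * (G Wf + Real.exp Pz * wtT Wf)) μ :=
    (hGI.add (hTI.const_mul _)).const_mul _
  have hG0 : ∀ Wf, 0 ≤ G Wf := fun Wf =>
    Finset.sum_nonneg fun r _ => mul_nonneg (hwt0 r Wf) (Real.exp_nonneg _)
  have hstep1 : ∫ Wf in E, U Wf ∂μ ≤ ∫ Wf in E, Real.exp (-c) * (G Wf + Real.exp Pz * wtT Wf) ∂μ :=
    integral_mono_ae hUI.integrableOn hRI.integrableOn ((ae_restrict_iff' hEm).mpr hpt)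
  have hstep2 : ∫ Wf in E, Real.exp (-c) * (G Wf + Real.exp Pz * wtT Wf) ∂μ ≤
      ∫ Wf, Real.exp (-c) * (G Wf + Real.exp Pz * wtT Wf) ∂μ :=
    setIntegral_le_integral hRI (ae_of_all _ fun Wf =>
      mul_nonneg (Real.exp_nonneg _) (add_nonneg (hG0 Wf) (mul_nonneg (Real.exp_nonneg _) (hwtT0 Wf))))
  have hstep3 : ∫ Wf, Real.exp (-c) * (G Wf + Real.exp Pz * wtT Wf) ∂μ =
      Real.exp (-c) * (∫ Wf, G Wf ∂μ + Real.exp Pz * ∫ Wf, wtT Wf ∂μ) := by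
    rw [integral_const_mul, integral_add hGI (hTI.const_mul _), integral_const_mul]
  have hstep4 : Real.exp (-c) * (∫ Wf, G Wf ∂μ + Real.exp Pz * ∫ Wf, wtT Wf ∂μ) ≤
      Real.exp (-c) * (MA + Real.exp Pz * MT) := by
    refine mul_le_mul_of_nonneg_left ?_ (Real.exp_nonneg _)
    exact add_le_add h4a.2 (mul_le_mul_of_nonneg_left hT2.2 (Real.exp_nonneg _))
  calc ∫ Wf in E, U Wf ∂μ ≤ ∫ Wf in E, Real.exp (-c) * (G Wf + Real.exp Pz * wtT Wf) ∂μ := hstep1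
    _ ≤ ∫ Wf, Real.exp (-c) * (G Wf + Real.exp Pz * wtT Wf) ∂μ := hstep2
    _ = Real.exp (-c) * (∫ Wf, G Wf ∂μ + Real.exp Pz * ∫ Wf, wtT Wf ∂μ) := hstep3
    _ ≤ Real.exp (-c) * (MA + Real.exp Pz * MT) := hstep4

end Concrete

/-! ### §2.2 The per-plaquette high tail for every odd `L ≥ 3` from one record and the stubs -/

/-- The unit `x_i = 1 + log g_{K−i}⁻¹` is monotone down the tower: `x_j ≤ x_i` for `i ≤ j` (and `≥ 1` for `0 < γ ≤ 1`). [cite: Balaban1985UV3, (3) p.256] -/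
theorem xlog_mono (F : T3Family) {γ : ℝ} (hγ : 0 < γ) {K i j : ℕ} (hij : i ≤ j) :
    1 + Real.log (Real.sqrt (γ * ((F.L : ℝ)⁻¹) ^ (K - j)))⁻¹ ≤ 1 + Real.log (Real.sqrt (γ * ((F.L : ℝ)⁻¹) ^ (K - i)))⁻¹ := by
  have hL1 : (1 : ℝ) ≤ (F.L : ℝ) := by exact_mod_cast F.hL.2.le
  have hLi0 : (0 : ℝ) < (F.L : ℝ)⁻¹ := inv_pos.mpr (zero_lt_one.trans_le hL1)
  have hLi1 : (F.L : ℝ)⁻¹ ≤ 1 := inv_le_one_of_one_le₀ hL1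
  have hpow : ((F.L : ℝ)⁻¹) ^ (K - i) ≤ ((F.L : ℝ)⁻¹) ^ (K - j) := pow_le_pow_of_le_one hLi0.le hLi1 (by omega)
  have hgi : 0 < Real.sqrt (γ * ((F.L : ℝ)⁻¹) ^ (K - i)) := Real.sqrt_pos.mpr (mul_pos hγ (pow_pos hLi0 _))
  have hle : Real.sqrt (γ * ((F.L : ℝ)⁻¹) ^ (K - i)) ≤ Real.sqrt (γ * ((F.L : ℝ)⁻¹) ^ (K - j)) :=
    Real.sqrt_le_sqrt (mul_le_mul_of_nonneg_left hpow hγ.le)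
  have := Real.log_le_log (inv_pos.mpr (hgi.trans_le hle)) (inv_anti₀ hgi hle)
  linarith

/-- Real bookkeeping of the numerator: `e^{−c}(e^{CM·xN³} + e^{Pz}e^{CT·xN³}) ≤ e^{−c + (CM+CP+CT+CL+1)·xN³}·I` when `Pz ≤ CP·xN³`, `e^{−CL·xN³} ≤ I`,
`xN³ ≥ 1`. [folklore] -/
theorem mass_budget {CM CP CT CL x N3 Pz I c : ℝ} (hCM : 0 ≤ CM) (hCP : 0 ≤ CP) (hCT : 0 ≤ CT) (ht : 1 ≤ x * N3)
    (hPz : Pz ≤ CP * (x * N3)) (hI : Real.exp (-(CL * x * N3)) ≤ I) :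
    Real.exp (-c) * (Real.exp (CM * x * N3) + Real.exp Pz * Real.exp (CT * x * N3)) ≤
      Real.exp (-c + (CM + CP + CT + CL + 1) * x * N3) * I := by
  set t : ℝ := x * N3 with htdef
  have ht0 : 0 ≤ t := zero_le_one.trans ht
  have e1 : CM * x * N3 = CM * t := by rw [htdef]; ring
  have e2 : CT * x * N3 = CT * t := by rw [htdef]; ring
  have e3 : -(CL * x * N3) = -(CL * t) := by rw [htdef]; ring
  have e4 : -c + (CM + CP + CT + CL + 1) * x * N3 = -c + (CM + CP + CT + CL + 1) * t := by rw [htdef]; ring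
  rw [e1, e2, e4]
  rw [e3] at hI
  have hA : Real.exp (CM * t) ≤ Real.exp ((CM + CP + CT) * t) :=
    Real.exp_le_exp.mpr (by nlinarith [mul_nonneg (add_nonneg hCP hCT) ht0])
  have hBB : Real.exp Pz * Real.exp (CT * t) ≤ Real.exp ((CM + CP + CT) * t) := by
    rw [← Real.exp_add]
    exact Real.exp_le_exp.mpr (by nlinarith [mul_nonneg hCM ht0])
  have h2 : (2 : ℝ) ≤ Real.exp t := by
    have := Real.add_one_le_exp t; linarith
  have hsum : Real.exp (CM * t) + Real.exp Pz * Real.exp (CT * t) ≤ Real.exp ((CM + CP + CT + 1) * t) := by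
    calc Real.exp (CM * t) + Real.exp Pz * Real.exp (CT * t) ≤ 2 * Real.exp ((CM + CP + CT) * t) := by linarith
      _ ≤ Real.exp t * Real.exp ((CM + CP + CT) * t) := mul_le_mul_of_nonneg_right h2 (Real.exp_nonneg _)
      _ = Real.exp ((CM + CP + CT + 1) * t) := by rw [← Real.exp_add]; ring_nf
  have hlow' : Real.exp ((CM + CP + CT + 1) * t) ≤ Real.exp ((CM + CP + CT + CL + 1) * t) * I := by
    have heq : Real.exp ((CM + CP + CT + 1) * t) = Real.exp ((CM + CP + CT + CL + 1) * t) * Real.exp (-(CL * t)) := by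
      rw [← Real.exp_add]; ring_nf
    rw [heq]
    exact mul_le_mul_of_nonneg_left hI (Real.exp_nonneg _)
  calc Real.exp (-c) * (Real.exp (CM * t) + Real.exp Pz * Real.exp (CT * t))
      ≤ Real.exp (-c) * (Real.exp ((CM + CP + CT + CL + 1) * t) * I) := mul_le_mul_of_nonneg_left (hsum.trans hlow') (Real.exp_nonneg _)
    _ = Real.exp (-c + (CM + CP + CT + CL + 1) * t) * I := by rw [← mul_assoc, ← Real.exp_add]

/-- **THE PER-PLAQUETTE HIGH TAIL AT THE RECORD'S PROFILE, every odd `L ≥ 3`** (v4's `stub_perPlaquetteHighRaw` conclusion with `(b₀, p₀, r₀) := (𝔠.b₀, 𝔠.p₀, 𝔠.r₀)`): from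
ONE record `𝔠` with family-uniform [7]-constants (STUB 2′'s output at a profile) — the lane's deliverables (STUB 2″), the exponent bound (4c), the history mass
(4a), the minorant mass (4b), the LANDED chessboard `chessboardRP_T3`, Mechanism A on the joint event from the DELIVERED envelopes of the concrete datum, the
|S|-th root, the exponent algebra. [cite: Balaban1985UV3, (5) p.256, (41) p.266, (47) p.267 and (71) p.273] -/
theorem perPlaquetteHigh_lane (L : ℕ) (hLo : Odd L) (hL : 1 < L) (𝔠 : AlphaConsts L (suGroupModel 2).N) (a₀ a₁ : ℝ)
    (ha0 : 0 < a₀) (ha1 : 0 < a₁) (hw : 𝔠.B₃ * a₁ ≤ a₀)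
    (h𝔠 : ∀ (F : T3Family) (hF : F.L = L), AlphaInputsT3AC.OfV2At F (hF ▸ 𝔠) a₀ a₁) :
    ∃ κ γ₁ : ℝ, 0 ≤ κ ∧ 0 < γ₁ ∧ γ₁ ≤ 1 ∧
      ∀ (F : T3Family) (γ : ℝ), F.L = L → 0 < γ → γ ≤ γ₁ →
        ∃ (j₀ : ℕ) (C : ℝ) (A : ℕ), 0 ≤ C ∧
          ∀ (K j : ℕ), j₀ < j → j ≤ K → ∀ p : Plaq (F.P K) j,
            (gibbsK F ℰp γ K).real
                {U | θBal F.L γ 𝔠.b₀ 𝔠.p₀ (K - j) ≤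
                  GaugeGroup.dist1 (GaugeField.plaqHol
                    (Averaging.iter (fun _ => BlockAveraging.blockAvg ℰp) j U) p)} ≤
              C * (F.scheme ℰp γ).β (K - j) ^ A *
                Real.exp (-(B10.pFun 𝔠.b₀ 𝔠.p₀ (Real.sqrt (γ * ((F.L : ℝ)⁻¹) ^ (K - j))) ^ 2 / 4) +
                  κ * (1 + Real.log (Real.sqrt (γ * ((F.L : ℝ)⁻¹) ^ (K - j)))⁻¹) ^ (2 + 3 * 𝔠.r₀)) := by
  -- the constants, all fixed with the record
  obtain ⟨γ₂, CP, κZ, hγ₂, hCP, hκZ, hLane⟩ := stub_alphaOfLaneFull L hLo hL 𝔠 a₀ a₁ ha0 ha1 hw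
  obtain ⟨γw, Bm, hγw, hBm, hWin⟩ := windowedWeights_v5p5Shape L hLo hL 𝔠 a₀ a₁ ha0 ha1 hw
  have hCT : (0 : ℝ) ≤ Bm := hBm
  set CT : ℝ := Bm with hCTdef
  obtain ⟨ccol, γc, hccol, hγc, h4c⟩ := stub_diluteExponent L hLo hL 𝔠 a₀ a₁ ha0 ha1 hw κZ hκZ
  obtain ⟨CM, γa, hCM, hγa, h4a⟩ :=
    Summit.QuantumFields.YangMills.Theorems.HistoryTailHistoryMassW.historyMassBound_of_weights_of_one_lt L hLo hL 𝔠 a₀ a₁ ha0 ha1 hw CP hCP Bm hBm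
  obtain ⟨CL, γb, hCL, hγb, h4b⟩ := stub_lowMass L hLo hL 𝔠 a₀ a₁ ha0 ha1 hw CP hCP
  obtain ⟨γθ, hγθ, hγθ1, hθle⟩ := T3Thresholds.exists_gamma_forall_θBal_le 𝔠.b₀_pos 𝔠.p₀_pos one_pos
  have hg0 : 0 < (min 𝔠.gamma0 1) ^ 2 := by have := 𝔠.gamma0_pos; positivity
  set C : ℝ := CM + CP + CT + CL + 1 with hCdef
  have hC0 : 0 ≤ C := by rw [hCdef]; positivity
  have hL0 : (0 : ℝ) ≤ (L : ℝ) := by positivity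
  refine ⟨8 * C * (L : ℝ) ^ 3 * (ccol + 4) ^ 3,
    min (min (min (min γ₂ γw) γc) (min γa γb)) (min (min γθ ((min 𝔠.gamma0 1) ^ 2)) 1), by positivity,
    by positivity, (min_le_right _ _).trans (min_le_right _ _), fun F γ hFL hγ hle => ?_⟩
  -- thresholds unpacked
  have hle2 : γ ≤ γ₂ := hle.trans ((min_le_left _ _).trans ((min_le_left _ _).trans ((min_le_left _ _).trans (min_le_left _ _))))
  have hlew : γ ≤ γw := hle.trans ((min_le_left _ _).trans ((min_le_left _ _).trans ((min_le_left _ _).trans (min_le_right _ _))))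
  have hlec : γ ≤ γc := hle.trans ((min_le_left _ _).trans ((min_le_left _ _).trans (min_le_right _ _)))
  have hlea : γ ≤ γa := hle.trans ((min_le_left _ _).trans ((min_le_right _ _).trans (min_le_left _ _)))
  have hleb : γ ≤ γb := hle.trans ((min_le_left _ _).trans ((min_le_right _ _).trans (min_le_right _ _)))
  have hleθ : γ ≤ γθ := hle.trans ((min_le_right _ _).trans ((min_le_left _ _).trans (min_le_left _ _)))
  have hleg : γ ≤ (min 𝔠.gamma0 1) ^ 2 := hle.trans ((min_le_right _ _).trans ((min_le_left _ _).trans (min_le_right _ _)))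
  have hγ1 : γ ≤ 1 := hle.trans ((min_le_right _ _).trans (min_le_right _ _))
  subst hFL
  have hL1 : 1 ≤ F.L := F.hL.2.le
  -- the concrete datum of this family
  have hOf : AlphaInputsT3AC.OfV2At F 𝔠 a₀ a₁ := h𝔠 F rfl
  have hc : 0 < a₀ ∧ 0 < a₁ ∧ 𝔠.B₃ * a₁ ≤ a₀ := ⟨ha0, ha1, hw⟩
  let π : AlphaInputsT3AC.PolymerT3 F := ⟨fun _ _ _ _ => ∅, fun _ _ _ _ => 0, fun _ _ Y => Y, fun _ _ _ => 0⟩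
  obtain ⟨hLP, hSF, hPS, hZ⟩ := hLane F rfl hOf hc γ hγ hleg π hle2
  obtain ⟨wt', hw0, hwz, hwAdm, hwI, hPm, h41I⟩ := hWin F rfl hOf hc γ hγ hleg π hlew
  have hExp := h4c F rfl hOf hc γ hγ hleg π hlec hLP hSF hZ
  have hMass := h4a F rfl hOf hc γ hγ hleg π (fun K j r _ Wf => wt' K j r Wf) hlea (fun K j r _ Wf => hw0 K j r Wf)
    (fun K j r _ Wf hra => hwz K j r Wf hra) hPS (fun K j r _ hjK hne => hwAdm K j r hjK (Nat.one_le_iff_ne_zero.mpr fun hj0 => hne (by subst hj0; exact Summit.QuantumFields.Balaban3D.Carriers.Hist.eq_triv_zero r))) (fun K j r _ hjK => hwI K j r hjK)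
    (fun K j r _ hjK => hPm K j r hjK)
  have hLow := h4b F rfl hOf hc γ hγ hleg π hleb hPS
  -- the datum with the windowed weights (regions, minimiser, main term, interaction, Zterm, χ, low, Rm unchanged)
  let D' : AlphaDataT3 F γ := { hOf.dataT3c hc γ hγ hleg π with
    LF := fun K j Wf Φ => wt' K j (Summit.QuantumFields.Balaban3D.Carriers.Hist.triv (F.P K) j) Wf *
        Real.exp (Φ (Summit.QuantumFields.Balaban3D.Carriers.Hist.triv (F.P K) j)) +
      ∑ r ∈ Finset.univ.erase (Summit.QuantumFields.Balaban3D.Carriers.Hist.triv (F.P K) j),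
        wt' K j r Wf * Real.exp (Φ r) }
  obtain ⟨CRm, hCRm⟩ := exp_two_Rm_le (hOf.dataT3c_rmSize hc γ hγ hleg π)
  have hCRm0 : 0 ≤ CRm := (Real.exp_pos _).le.trans (hCRm 0 0 le_rfl)
  refine ⟨0, max 1 CRm, 0, le_trans zero_le_one (le_max_left _ _), fun K j hj hjK p => ?_⟩
  have hj1 : 1 ≤ j := hj
  -- names for the scale-`K−j` quantities
  set g : ℝ := Real.sqrt (γ * ((F.L : ℝ)⁻¹) ^ (K - j)) with hg
  set x : ℝ := 1 + Real.log g⁻¹ with hx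
  set θ : ℝ := θBal F.L γ 𝔠.b₀ 𝔠.p₀ (K - j) with hθ
  set N : ℝ := ((F.P K).sitesPerDir j : ℝ) with hN
  have hgpos : 0 < g := (sqrt_coupling_pos_le hL1 hγ (K - j)).1
  have hg1 : g ≤ 1 := coupling_le_one hL1 hγ hγ1 (K - j)
  have hx1 : 1 ≤ x := by
    have : 0 ≤ Real.log g⁻¹ := Real.log_nonneg (one_le_inv_iff₀.mpr ⟨hgpos, hg1⟩)
    linarith
  have hr₀ : 0 ≤ 𝔠.r₀ := zero_le_one.trans 𝔠.one_le_r₀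
  have hxr : 1 ≤ x ^ 𝔠.r₀ := Real.one_le_rpow hx1 hr₀
  have hN1 : 1 ≤ N := by
    rw [hN]; exact_mod_cast Nat.one_le_iff_ne_zero.mpr ((F.P K).sitesPerDir_ne_zero j)
  have hN3 : 1 ≤ N ^ 3 := one_le_pow₀ hN1
  have hxN : 1 ≤ x * N ^ 3 := one_le_mul_of_one_le_of_one_le hx1 hN3
  -- the chessboard family at separation `ρ = ccol·x^{r₀}`
  have hρ1 : 1 ≤ ccol * x ^ 𝔠.r₀ := one_le_mul_of_one_le_of_one_le hccol hxr
  obtain ⟨S, hpS, hsep, hcount, hchess⟩ :=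
    HistoryTailChessboardT3.chessboardRP_T3 F.L hLo hL F γ rfl hγ hγ1 θ K j hjK (ccol * x ^ 𝔠.r₀) hρ1 p
  have hcard : 1 ≤ S.card := Finset.card_pos.mpr ⟨p, hpS⟩
  -- the numerator bound: exponent (4c) + history mass (4a) + trivial mass (2″f) + minorant mass (4b)
  set P4 : ℝ := B10.pFun 𝔠.b₀ 𝔠.p₀ g ^ 2 / 4 with hP4
  set σ : ℕ → ℝ := fun i => 𝔠.b₀ ^ 2 / 200 *
      (1 + Real.log (Real.sqrt (γ * ((F.L : ℝ)⁻¹) ^ (K - i)))⁻¹) ^ (2 * 𝔠.p₀ - 1) *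
      ((1 + Real.log (Real.sqrt (γ * ((F.L : ℝ)⁻¹) ^ (K - i)))⁻¹) - (1 + Real.log (Real.sqrt (γ * ((F.L : ℝ)⁻¹) ^ (K - j)))⁻¹)) with hσdef
  have hσ0 : ∀ i, i < j → 0 ≤ σ i := by
    intro i hij
    have hxi : 1 ≤ 1 + Real.log (Real.sqrt (γ * ((F.L : ℝ)⁻¹) ^ (K - i)))⁻¹ := hx1.trans (xlog_mono F hγ hij.le)
    have h1 : 0 ≤ (1 + Real.log (Real.sqrt (γ * ((F.L : ℝ)⁻¹) ^ (K - i)))⁻¹) ^ (2 * 𝔠.p₀ - 1) :=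
      Real.rpow_nonneg (zero_le_one.trans hxi) _
    have h2 : 0 ≤ (1 + Real.log (Real.sqrt (γ * ((F.L : ℝ)⁻¹) ^ (K - i)))⁻¹) - (1 + Real.log (Real.sqrt (γ * ((F.L : ℝ)⁻¹) ^ (K - j)))⁻¹) :=
      sub_nonneg.mpr (xlog_mono F hγ hij.le)
    have hb : 0 ≤ 𝔠.b₀ ^ 2 / 200 := by positivity
    exact mul_nonneg (mul_nonneg hb h1) h2
  let v₀ : (i : Fin j) → GaugeField (F.P K) i (Matrix.specialUnitaryGroup (Fin 2) ℂ) := fun _ => 1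
  set Pz : ℝ := CP * θBal F.L γ 𝔠.b₀ 𝔠.p₀ (K - j + 1) ^ 2 * N ^ 3 with hPz
  have hθ1 : θBal F.L γ 𝔠.b₀ 𝔠.p₀ (K - j + 1) ≤ 1 := hθle F.L hL1 γ hγ hleθ (K - j + 1)
  have hθ0' : 0 ≤ θBal F.L γ 𝔠.b₀ 𝔠.p₀ (K - j + 1) :=
    (T3MinimiserStabilityReduction.θBal_pos hL1 hγ hγ1 𝔠.b₀_pos 𝔠.p₀ (K - j + 1)).le
  have hPzle : Pz ≤ CP * (x * N ^ 3) := by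
    have hsq : θBal F.L γ 𝔠.b₀ 𝔠.p₀ (K - j + 1) ^ 2 ≤ 1 := pow_le_one₀ hθ0' hθ1
    have hN30 : 0 ≤ N ^ 3 := zero_le_one.trans hN3
    calc Pz = CP * (θBal F.L γ 𝔠.b₀ 𝔠.p₀ (K - j + 1) ^ 2 * N ^ 3) := by rw [hPz]; ring
      _ ≤ CP * (1 * N ^ 3) := mul_le_mul_of_nonneg_left (mul_le_mul_of_nonneg_right hsq hN30) hCP
      _ ≤ CP * (x * N ^ 3) := mul_le_mul_of_nonneg_left (mul_le_mul_of_nonneg_right hx1 hN30) hCP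
  have h2le : Bm ≤ Real.exp (CT * x * N ^ 3) := by
    calc Bm ≤ Bm + 1 := by linarith
      _ ≤ Real.exp Bm := Real.add_one_le_exp Bm
      _ ≤ Real.exp (CT * x * N ^ 3) := Real.exp_le_exp.mpr (by rw [hCTdef]; nlinarith [hxN, hBm])
  have hnumer := setIntegral_up_le hOf hc γ hγ hleg π K j S θ P4 (Real.exp (CM * x * N ^ 3)) (Real.exp (CT * x * N ^ 3)) Pz σ hσ0
    (fun r Wf => wt' K j r Wf) (fun r Wf => hw0 K j r Wf)
    (AlphaDataT3.up D' K j) (wt' K j (Summit.QuantumFields.Balaban3D.Carriers.Hist.triv (F.P K) j))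
    (fun Wf => hw0 K j _ Wf) (fun Wf => rfl)
    (fun r Wf hadm hWE => hExp K j hjK r v₀ Wf hadm S hWE hsep)
    (fun r _ => hwAdm K j r hjK hj1) (hwAdm K j _ hjK hj1)
    (fun r Wf hadm => (abs_le.mp (hPS K j r Wf hjK hj1 hadm)).2)
    (hMass K j hjK v₀) ⟨(hwI K j _ hjK).1, (hwI K j _ hjK).2.trans h2le⟩
    (h41I K j hjK).2
  -- the bound `B` against `∫ low`
  have hlowmass : Real.exp (-(CL * x * N ^ 3)) ≤
      ∫ Wf, (hOf.dataT3c hc γ hγ hleg π).low K j Wf ∂fieldMeasure (F.P K) j (Matrix.specialUnitaryGroup (Fin 2) ℂ) := hLow K j hjK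
  have hB := mass_budget (c := (S.card : ℝ) * P4) hCM hCP hCT hxN hPzle hlowmass
  have hnum := hnumer.trans hB
  -- Mechanism A on the joint event from the DELIVERED envelopes
  have h47' : Ineq47AE D' K j := hOf.dataT3c_ineq47AE hc γ hγ hleg π K j hjK
  have hreg' : EnvelopeRegular D' K j :=
    ⟨hOf.dataT3c_integrable_low hc γ hγ hleg π K j hjK, (h41I K j hjK).2, hOf.dataT3c_integral_low_pos hc γ hγ hleg π K j hjK⟩
  have hinter := gibbsK_real_iInter_le (D := D') hγ.le hjK (h41I K j hjK).1 h47' hreg'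
    (fun Wf => T3AlphaInputsAC.low_nonneg (hOf.dataT3c_chiRange hc γ hγ hleg π) K j Wf) S θ _ hnum
  have hB2 : (gibbsK F ℰp γ K).real
        {U | ∀ q ∈ S, θ ≤ GaugeGroup.dist1 (GaugeField.plaqHol
          (Averaging.iter (fun _ => BlockAveraging.blockAvg ℰp) j U) q)} ≤
      CRm * Real.exp (-((S.card : ℝ) * P4) + (CM + CP + CT + CL + 1) * x * N ^ 3) :=
    hinter.trans (mul_le_mul_of_nonneg_right (hCRm K j hjK) (Real.exp_nonneg _))
  -- the root and the exponent
  have hE_eq : -((S.card : ℝ) * P4) + (CM + CP + CT + CL + 1) * x * N ^ 3 = -P4 * (S.card : ℝ) + C * x * N ^ 3 := by rw [hCdef]; ring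
  rw [hE_eq] at hB2
  have hroot := root_bound (E := -P4 * (S.card : ℝ) + C * x * N ^ 3) hcard measureReal_nonneg hCRm0 hchess hB2
  have hcount' : N ^ 3 ≤ (S.card : ℝ) * (8 * ((F.L : ℝ) * (ccol * x ^ 𝔠.r₀ + 4)) ^ 3) := by rw [hN]; exact hcount
  have hexp := exponent_bound (P4 := P4) (C := C) hcard hC0 hx1 hL0 hccol hr₀ hcount'
  have hfinal : max 1 CRm * Real.exp ((-P4 * (S.card : ℝ) + C * x * N ^ 3) / S.card) ≤
      max 1 CRm * Real.exp (-P4 + 8 * C * (F.L : ℝ) ^ 3 * (ccol + 4) ^ 3 * x ^ (2 + 3 * 𝔠.r₀)) :=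
    mul_le_mul_of_nonneg_left (Real.exp_le_exp.mpr hexp) (le_trans zero_le_one (le_max_left _ _))
  calc (gibbsK F ℰp γ K).real
          {U | θ ≤ GaugeGroup.dist1 (GaugeField.plaqHol (Averaging.iter (fun _ => BlockAveraging.blockAvg ℰp) j U) p)}
        ≤ max 1 CRm * Real.exp (-P4 + 8 * C * (F.L : ℝ) ^ 3 * (ccol + 4) ^ 3 * x ^ (2 + 3 * 𝔠.r₀)) := hroot.trans hfinal
    _ = max 1 CRm * (F.scheme ℰp γ).β (K - j) ^ 0 *
          Real.exp (-(B10.pFun 𝔠.b₀ 𝔠.p₀ g ^ 2 / 4) + 8 * C * (F.L : ℝ) ^ 3 * (ccol + 4) ^ 3 * x ^ (2 + 3 * 𝔠.r₀)) := by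
          rw [pow_zero, mul_one, hP4]

/-! ### §2.3 The per-plaquette tail for every admissible block size, in the v3′ threshold form -/

/-- **THE PER-PLAQUETTE HIGH TAIL, THRESHOLD FORM** (v4's `stub_perPlaquetteHighRaw` text with the profile chosen beyond given thresholds): for EVERY odd `L ≥ 3` from
STUB 2′'s records at the profile `(max b₁ b₁′, max p₁ p₁′)` and `perPlaquetteHigh_lane` (no small-block residue). [cite: Balaban1985UV3, (5) p.256 and (71) p.273] -/
theorem perPlaquetteHighL :
    ∀ (L : ℕ), Odd L → 1 < L → ∀ (b₁ p₁ : ℝ),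
      ∃ b₀ p₀ r₀ κ : ℝ, b₁ ≤ b₀ ∧ p₁ ≤ p₀ ∧ 0 < b₀ ∧ 2 < p₀ ∧ 0 ≤ r₀ ∧ 0 ≤ κ ∧ 1 + 3 * r₀ / 2 < p₀ ∧
        ∃ γ₁ : ℝ, 0 < γ₁ ∧ γ₁ ≤ 1 ∧
          ∀ (F : T3Family) (γ : ℝ), F.L = L → 0 < γ → γ ≤ γ₁ →
            ∃ (j₀ : ℕ) (C : ℝ) (A : ℕ), 0 ≤ C ∧
              ∀ (K j : ℕ), j₀ < j → j ≤ K → ∀ p : Plaq (F.P K) j,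
                (gibbsK F ℰp γ K).real
                    {U | θBal F.L γ b₀ p₀ (K - j) ≤
                      GaugeGroup.dist1 (GaugeField.plaqHol
                        (Averaging.iter (fun _ => BlockAveraging.blockAvg ℰp) j U) p)} ≤
                  C * (F.scheme ℰp γ).β (K - j) ^ A *
                    Real.exp (-(B10.pFun b₀ p₀ (Real.sqrt (γ * ((F.L : ℝ)⁻¹) ^ (K - j))) ^ 2 / 4) +
                      κ * (1 + Real.log (Real.sqrt (γ * ((F.L : ℝ)⁻¹) ^ (K - j)))⁻¹) ^ (2 + 3 * r₀)) := by
  intro L hLo hL b₁ p₁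
  obtain ⟨b₁', p₁', hrec⟩ := stub_laneRecords L hLo hL
  obtain ⟨𝔠, a₀, a₁, hcb, hcp, ha0, ha1, hw, h𝔠⟩ := hrec (max b₁ b₁') (max p₁ p₁') (le_max_right _ _) (le_max_right _ _)
  obtain ⟨κ, γ₁, hκ, hγ₁, hγ₁1, hhigh⟩ := perPlaquetteHigh_lane L hLo hL 𝔠 a₀ a₁ ha0 ha1 hw h𝔠
  have hr₀ : 0 ≤ 𝔠.r₀ := zero_le_one.trans 𝔠.one_le_r₀
  have hp : 1 + 3 * 𝔠.r₀ / 2 < 𝔠.p₀ := by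
    have := 𝔠.one_le_r₀
    show 1 + 3 * 𝔠.r₀ / 2 < 2 * 𝔠.r₀ + 1
    linarith
  refine ⟨𝔠.b₀, 𝔠.p₀, 𝔠.r₀, κ, hcb ▸ le_max_left _ _, hcp ▸ le_max_left _ _, 𝔠.b₀_pos, 𝔠.two_lt_p₀, hr₀, hκ, hp,
    γ₁, hγ₁, hγ₁1, hhigh⟩

/-! ### §2.4 The crux BY NAME -/

/-- **`HistoryTailL ⇐ stub_laneRecords ∧ stub_alphaOfLaneFull ∧ stub_windowedWeights`** (4a/4b/4c landed, «1 < L» editions)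
(+ LANDED: `HistoryTailChessboardT3.chessboardRP_T3` p481363, `HistoryTailBirthV4.stub_budget` p442213, `HistoryTailBoundedHeight.perPlaquette_of_split` p438760,
`HistoryTailBirthV3b.stub_tailOfPerPlaquette` p432346, `historyTailAt_of_averagedTailAt`, alpha-1's v2 datum rows) — the v3′ load-bearing item
stmt-QuantumFields-19936 BY NAME; the profile is fixed BEFORE the free top fraction `m`. [cite: Balaban1985UV3, (5) p.256 and (71) p.273; King1986, (3.12) p.657] -/
theorem HistoryTailL_of : Summit.QuantumFields.YangMills.Theses.UnitScaleTilt.HistoryTailL := by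
  intro L b₁ p₁
  by_cases hL : Odd L ∧ 1 < L
  · obtain ⟨b₀, p₀, r₀, κ, hb1, hp1, hb, hp2, hr₀, hκ, hp, γ₁, hγ₁, hγ₁1, h⟩ := perPlaquetteHighL L hL.1 hL.2 b₁ p₁
    obtain ⟨C₆, c, hC₆, hc, hbud⟩ := HistoryTailBirthV4.stub_budget b₀ p₀ r₀ κ hb hr₀ hκ hp
    refine ⟨b₀, p₀, hb1, hp1, hb, hp2, fun m hm => ⟨γ₁, hγ₁, fun F γ hFL hγ hle => ?_⟩⟩
    have hγ1 : γ ≤ 1 := hle.trans hγ₁1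
    have hp01 : (1 : ℝ) ≤ p₀ := by linarith
    have hL1 : 1 ≤ F.L := F.hL.2.le
    obtain ⟨j₀, C, A, hC, hhigh⟩ := h F γ hFL hγ hle
    have hhigh' : ∃ (C : ℝ) (A : ℕ) (c : ℝ), 0 ≤ C ∧ 0 < c ∧
        ∀ (K j : ℕ), j₀ < j → j ≤ K → ∀ p : Plaq (F.P K) j,
          (gibbsK F ℰp γ K).real
              {U | θBal F.L γ b₀ p₀ (K - j) ≤
                GaugeGroup.dist1 (GaugeField.plaqHol
                  (Averaging.iter (fun _ => BlockAveraging.blockAvg ℰp) j U) p)} ≤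
            C * (F.scheme ℰp γ).β (K - j) ^ A *
              Real.exp (-(c * B10.pFun b₀ p₀ (Real.sqrt (γ * ((F.L : ℝ)⁻¹) ^ (K - j))) ^ 2)) := by
      refine ⟨C * C₆, A, c, mul_nonneg hC hC₆, hc, fun K j hj hjK p => ?_⟩
      have hg := sqrt_coupling_pos_le hL1 hγ (K - j)
      have hg1 := coupling_le_one hL1 hγ hγ1 (K - j)
      have hβA : 0 ≤ C * (F.scheme ℰp γ).β (K - j) ^ A :=
        mul_nonneg hC (pow_nonneg (F.scheme_β_nonneg ℰp hγ.le (K - j)) A)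
      calc (gibbsK F ℰp γ K).real
              {U | θBal F.L γ b₀ p₀ (K - j) ≤
                GaugeGroup.dist1 (GaugeField.plaqHol
                  (Averaging.iter (fun _ => BlockAveraging.blockAvg ℰp) j U) p)}
            ≤ C * (F.scheme ℰp γ).β (K - j) ^ A *
                Real.exp (-(B10.pFun b₀ p₀ (Real.sqrt (γ * ((F.L : ℝ)⁻¹) ^ (K - j))) ^ 2 / 4) +
                  κ * (1 + Real.log (Real.sqrt (γ * ((F.L : ℝ)⁻¹) ^ (K - j)))⁻¹) ^ (2 + 3 * r₀)) := hhigh K j hj hjK p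
        _ ≤ C * (F.scheme ℰp γ).β (K - j) ^ A *
                (C₆ * Real.exp (-(c * B10.pFun b₀ p₀ (Real.sqrt (γ * ((F.L : ℝ)⁻¹) ^ (K - j))) ^ 2))) :=
              mul_le_mul_of_nonneg_left (hbud _ hg.1 hg1) hβA
        _ = C * C₆ * (F.scheme ℰp γ).β (K - j) ^ A *
                Real.exp (-(c * B10.pFun b₀ p₀ (Real.sqrt (γ * ((F.L : ℝ)⁻¹) ^ (K - j))) ^ 2)) := by ring
    have hPP := HistoryTailBoundedHeight.perPlaquette_of_split j₀ F hγ hγ1 hb.le p₀ hhigh'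
    exact historyTailAt_of_averagedTailAt F hγ hγ1 hb hp01 hm
      (HistoryTailBirthV3b.stub_tailOfPerPlaquette F γ b₀ p₀ hγ hγ1 hb hp01 hPP)
  · refine ⟨max b₁ 1, max p₁ 3, le_max_left _ _, le_max_left _ _, lt_of_lt_of_le one_pos (le_max_right _ _),
      lt_of_lt_of_le (by norm_num) (le_max_right _ _), fun m _ => ⟨1, one_pos, fun F γ hFL _ _ => ?_⟩⟩
    have hF := F.hL
    rw [hFL] at hF
    exact (hL hF).elim

end Summit.QuantumFields.YangMills.Cruxes.HistoryTailL.BirthV5p6pre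

end
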